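import Literature.AlgebraicGeometry.Surfaces.K3PeriodSurjectivityProofs
import Literature.AlgebraicGeometry.Surfaces.K3Marking
import Literature.AlgebraicGeometry.HodgeTheory.RationalLatticeIntegral
import Literature.AlgebraicGeometry.HodgeTheory.ComplexGysinOrientation
import Literature.AlgebraicTopology.SingularHomology.PoincareDualityCorollaries
import Literature.LinearAlgebra.QuadraticForm.CartanDieudonne
import HarnessLib

/-!
# Buskin's theorem — inline partial steps: the reduction of a rational isometry of `Λ_{K3} ⊗ ℚ`
# to reflections along lattice vectors, the chain of projective period points, and the assembly
# of the printed proof modulo its remaining ingredients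
# (Buskin 2019 §6.2, proof of Thm. 1.1; Huybrechts 2019 §1.1)

Companion ("Proofs" sibling, D-0026: theorems and definitions with bodies only, no named fact) to
`K3Surface.lean`, whose named fact `Buskin2019_hodgeIsometry_algebraic` (Buskin, J. reine angew.
Math. 755 (2019), Thm. 1.1, read on the held arXiv text 1510.02852, §6.2 p. 22; reproof
Huybrechts, Comment. Math. Helv. 94 (2019), read on the held arXiv text 1705.04063, §1.1) is NOT
discharged here. Both published proofs open with the same reduction, verbatim (Buskin §6.2,
proof of Thm. 1.1): "Consider a general Hodge isometry `φ : H²(S, ℚ) → H²(S', ℚ)` inducing via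
markings `η, η'` an isometry `ϕ : Λ_ℚ → Λ_ℚ`. The isometry `ϕ` decomposes as a composition of
cyclic type isometries, `ϕ = ϕ_k ∘ ⋯ ∘ ϕ_1` by the Cartan–Dieudonné theorem. […] Starting with `S`
and using the surjectivity of the period map for marked K3 surfaces we obtain a sequence of
marked K3 surfaces `(S, η), (S_1, η_1), …, (S_{k-1}, η_{k-1}), (S', η')`, with periods
`[η(σ_S)]`, `l_i = ϕ̃_i ∘ ⋯ ∘ ϕ̃_1([η(σ_S)])`, `i = 1, …, k`, so that `l_k = [η'(σ_{S'})]`."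
(Huybrechts §1.1: "for any lattice `Λ` and any rational isometry `φ : Λ_ℚ ≅ Λ_ℚ`, there exist
`b_i ∈ Λ_ℚ`, `i = 1, …, k`, with `(b_i)² ≠ 0`, such that `φ` equals the composition
`φ = s_{b_1} ∘ ⋯ ∘ s_{b_k}` of reflections `s_{b_i} : x ↦ x - (2(x.b_i)/(b_i)²) b_i`. […] Clearly,
we may assume that all `b_i ∈ Λ_ℚ` are contained in the lattice `Λ` […]. Combining this with the
surjectivity of the period map, one finds that any Hodge isometry `H²(S, ℚ) ≅ H²(S', ℚ)` can be
written as a composition of Hodge isometries `H²(S = S_0, ℚ) ≅ H²(S_1, ℚ) ≅ ⋯ ≅ H²(S_n = S', ℚ)`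
such that after choosing markings […] the Hodge isometry `H²(S_i, ℚ) ≅ H²(S_{i+1}, ℚ)` is of the
form `s_{b_i}`.") The remaining steps (Buskin Prop. 6.2: cyclic-type Hodge isometries of
projective K3 surfaces are algebraic — Mukai's moduli of sheaves, twistor lines, Verbitsky's
hyperholomorphic transport, global Torelli; Lemma 6.3/6.4: composition and push-forward of
algebraic correspondences) are theories the tree does not have and are NOT proved here;
together with the markings of the GIVEN K3 surfaces (Huybrechts, *Lectures on K3 Surfaces*,
Ch. 1 Prop. 3.5) they enter the final assembly theorem below as explicit hypotheses.

What IS proved here, in the vocabulary of `K3PeriodSurjectivity.lean` (`K3Index`, `k3Gram`,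
`k3Form`; the period point `x ∈ Λ_ℂ` with `(x.x) = 0`, `(x̄.x) > 0` and a positive lattice vector
in `x^⊥` — the hypotheses of the tree's projective surjectivity fact
`Huybrechts_K3_periodSurjective_projective`) and of the tree's Cartan–Dieudonné theorem
(`Literature.LinearAlgebra.QuadraticForm.exists_eq_prod_reflections`, `reflection`):

* `k3FormRat`, `k3FormC`: the K3 form on `Λ_ℚ = ℚ²²` and on `Λ_ℂ` as Mathlib bilinear forms
  (`Matrix.toBilin'` of the Gram matrix; `k3FormC = k3Form`), symmetric, and NON-DEGENERATE over
  `ℚ` (from unimodularity `det Λ_{K3} = -1`, `k3Gram_det` of the sibling Proofs file);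
* `k3ReflectionC v`: the `ℂ`-linear extension to `Λ_ℂ` of the reflection `s_v` along a lattice
  vector `v ∈ Λ = ℤ²²`; it preserves `k3Form`, commutes with complex conjugation, and maps `Λ_ℚ`
  to `Λ_ℚ` (`k3ReflectionC_ratCast`);
* STEP 1 (Cartan–Dieudonné over `ℚ`, then clearing denominators, Huybrechts' "we may assume that
  all `b_i` are contained in the lattice `Λ`"): every `ℂ`-linear `k3Form`-isometry `σ` of `Λ_ℂ`
  DEFINED OVER `ℚ` (it maps `Λ` into `Λ_ℚ`) is a product of at most `44 = 2 · rk Λ` reflections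
  `k3ReflectionC v_i` along non-isotropic LATTICE vectors `v_i`
  (`exists_eq_prod_k3ReflectionC`; the sharp bound `rk Λ` of E. Cartan is not needed and not
  proved);
* STEP 2 (why the intermediate surfaces exist and are PROJECTIVE, as Prop. 6.2 requires): the
  hypotheses of `Huybrechts_K3_periodSurjective_projective` at a period vector `x` imply the same
  hypotheses at `s_v(x)` for every lattice vector `v` — `s_v` is a real isometry, and it carries a
  positive lattice vector `u ∈ x^⊥` to the positive rational vector `s_v(u) ∈ s_v(x)^⊥`, a multiple
  of which is in `Λ` (`k3PeriodHypotheses_k3ReflectionC`, `k3PeriodHypotheses_prod_k3ReflectionC`);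
* ASSEMBLY (`exists_markedK3Chain`): granted the surjectivity fact (hypothesis
  `h : Huybrechts_K3_periodSurjective_projective`, an EXISTING named fact of the tree, not restated),
  for every such `σ` and every projective period vector `x` there is a list of non-isotropic lattice
  vectors `v_1, …, v_m` (`m ≤ 44`) with `σ = s_{v_1} ∘ ⋯ ∘ s_{v_m}` such that every intermediate
  period `l = s_{v_{k+1}} ∘ ⋯ ∘ s_{v_m}(x)` is the period of a MARKED ALGEBRAIC K3 SURFACE
  `(S_k, η_k)` in the sense of that fact — Buskin's "sequence of marked K3 surfaces … with periods
  `l_i`".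
* NO ANTI-ISOMETRIES (`not_antiIsometry_k3FormRat`, `not_antiIsometry_k3Form`): `Λ_ℚ` has no
  `ℚ`-linear anti-isometry — the form is negative definite on the `16`-dimensional block
  `E₈(−1)^{⊕2} ⊗ ℚ` (Lagrange's completion of squares of the sibling Proofs file, cleared of
  denominators) and Grassmann's dimension formula bounds two trivially-meeting `16`-dimensional
  subspaces of `ℚ²²` — so the signs of the integral generators `p, p'` of `H⁴` in the named fact are
  immaterial: they agree with those of any markings up to sign (`eq_or_eq_neg_of_zsmul`,
  `k3Form_markingConj_signed`) and opposite signs make the isometry hypothesis contradictory;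
* THE WHOLE PRINTED PROOF MODULO ITS REMAINING INGREDIENTS
  (`corr_prod_k3ReflectionC_of_reflective`, `Buskin2019_hodgeIsometry_algebraic_of_reflective`):
  granted the surjectivity fact `h`, markings with projective periods of the GIVEN K3 surfaces
  (`hmark`: Huybrechts Ch. 1 Prop. 3.5, Ch. 3 Def. 2.3, Ch. 6 §1.1 and Prop. 2.3), Buskin's Prop. 6.2
  for the reflective isometries `η⁻¹ ∘ s_v ∘ η'` between marked projective K3 surfaces (`hrefl`) and
  his Lemma 6.3 with the composition rule `[γ]_* ∘ [γ']_* = [γ'']_*` for correspondences (`hcomp`) —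
  each a distinct printed result, taken as an explicit hypothesis stated in the tree's vocabulary and
  NOT vendored as a named fact (D-0026) — the named fact `Buskin2019_hodgeIsometry_algebraic`
  follows exactly as printed: signs of `p, p'`; Cartan–Dieudonné; the chain of marked projective K3
  surfaces; period compatibility from the preservation of the type `(2,0)`; composition along the
  chain by induction. What `Buskin2019_hodgeIsometry_algebraic_holds` still needs is exactly
  `h`, `hmark`, `hrefl`, `hcomp`.
* THE MARKINGS INGREDIENT FROM THE TREE'S FACT (`Buskin2019_hodgeIsometry_algebraic_of_marking`,
  `ne_zero_of_cupProduct_eq_k3Form_smul`): the hypothesis `hmark` is now the tree's named fact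
  `Huybrechts_K3_marking_exists` (`K3Marking.lean`: every K3 surface admits a marking whose period
  point is a projective period point, Huybrechts Ch. 1 Prop. 3.5, Ch. 3 Def. 2.3, Ch. 6 §1.1 and
  Prop. 1.2 — stated there symbol for symbol in the shape of `hmark`), so the assembly runs from the
  two EXISTING named facts `Huybrechts_K3_periodSurjective_projective`, `Huybrechts_K3_marking_exists`
  and the two printed results `hrefl` (Prop. 6.2), `hcomp` (Lemma 6.3) — exactly what
  `Buskin2019_hodgeIsometry_algebraic_holds` still needs. Recorded alongside: the clause `p ≠ 0` of a
  marking is AUTOMATIC — if `p = 0` every cup product `H² × H² → H⁴` vanishes, so the Poincaré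
  pairing of the closed `4`-manifold `S(ℂ)`, perfect over `ℂ` (Hatcher Prop. 3.38, the tree's
  theorem `isPerfPair_cupPairing_of_field_holds`), forces `H²(S(ℂ); ℂ) = 0`, contradicting
  `H²(S(ℂ); ℂ) ≅ Λ_ℂ = ℂ²²` (`ne_zero_of_cupProduct_eq_k3Form_smul`, for provers of that fact).
* Section `OrientationTransport`: ONE orientation family suffices for `hrefl` and `hcomp`. Two
  orientation families give proportional Gysin morphisms `complexGysin μ = c • complexGysin μ₀`,
  `c ≠ 0` (the tree's `HodgeTheory.complexGysin_eq_smul_of_orientationFamily`: `X(ℂ)` is connected,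
  Fulton, *Young Tableaux*, App. B §B.1 (5), Hatcher Thm. 3.26), and `algebraicClasses` is a
  `ℂ`-submodule, so `hrefl` / `hcomp` at a single family `μ₀` give them at every family
  (`reflective_of_orientationFamily`, `corrComp_of_orientationFamily`), whence
  `Buskin2019_hodgeIsometry_algebraic_of_reflective_at`: Thm. 1.1 from the two period facts and
  Prop. 6.2 / Lemma 6.3 required at `μ₀` only.

## References

* [Buskin2019] N. Buskin, Every rational Hodge isometry between two K3 surfaces is algebraic,
  J. reine angew. Math. 755 (2019) 127–150 (arXiv:1510.02852), §6.2, proof of Thm. 1.1, and §3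
  Example 3.2 (reflections along primitive lattice vectors are of cyclic type).
* [Huybrechts2019] D. Huybrechts, Motives of isogenous K3 surfaces, Comment. Math. Helv. 94 (2019)
  445–458 (arXiv:1705.04063), §1.1.
* [Huybrechts2016K3] D. Huybrechts, Lectures on K3 Surfaces, CUP 2016, Ch. 1 Prop. 3.5, Ch. 3
  Def. 2.3, Ch. 6 §1.1, Prop. 1.2, Prop. 2.3 and Rem. 3.3, Ch. 14 §0.3.
* [Iversen1992] B. Iversen, Hyperbolic Geometry, LMS Student Texts 25, CUP 1992, Ch. I §2.
* [HatcherAT2002] A. Hatcher, Algebraic Topology, CUP 2002, §3.3 Thm. 3.26 and Prop. 3.38.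
* [FultonYoungTableaux1997] W. Fulton, Young Tableaux, CUP 1997, Appendix B §B.1 (1)–(5).
* [Fulton1998] W. Fulton, Intersection Theory, 2nd ed., Springer 1998, Prop. 16.1.1.
-/

noncomputable section

open CategoryTheory
open Literature.AlgebraicTopology.SingularHomology
open Literature.LinearAlgebra.QuadraticForm

namespace Literature.AlgebraicGeometry.Surfaces

/-! ### The K3 form as a Mathlib bilinear form, over `ℚ` and over `ℂ` -/

/-- The rational K3 form on `Λ_ℚ = Λ_{K3} ⊗ ℚ = ℚ²²`: `(a.b) = Σᵢⱼ aᵢ Λᵢⱼ bⱼ`, as a Mathlib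
bilinear form. [cite: Buskin2019, §3 (the rationalised lattice `L_ℚ`) and §6.2] -/
def k3FormRat : LinearMap.BilinForm ℚ (K3Index → ℚ) :=
  Matrix.toBilin' (k3Gram.map (Int.cast : ℤ → ℚ))

/-- The complex K3 form on `Λ_ℂ = ℂ²²` as a Mathlib bilinear form; it is the sibling file's
`k3Form` (`k3FormC_apply`). [cite: Huybrechts2016K3, Ch. 6 §1.1] -/
def k3FormC : LinearMap.BilinForm ℂ (K3Index → ℂ) :=
  Matrix.toBilin' (k3Gram.map (Int.cast : ℤ → ℂ))

/-- `k3FormC` is the K3 form `k3Form` of `K3PeriodSurjectivity.lean`. [folklore] -/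
@[simp] theorem k3FormC_apply (a b : K3Index → ℂ) : k3FormC a b = k3Form a b := by
  rw [k3FormC, Matrix.toBilin'_apply]
  rfl

/-- The defining double sum of the rational K3 form. [folklore] -/
theorem k3FormRat_apply (a b : K3Index → ℚ) :
    k3FormRat a b = ∑ i, ∑ j, a i * (k3Gram i j : ℚ) * b j := by
  rw [k3FormRat, Matrix.toBilin'_apply]
  rfl

/-- The complex K3 form restricted to `Λ_ℚ ⊂ Λ_ℂ` is the rational K3 form. [folklore] -/
theorem k3Form_ratCast (a b : K3Index → ℚ) :
    k3Form (fun i => (a i : ℂ)) (fun i => (b i : ℂ)) = ((k3FormRat a b : ℚ) : ℂ) := by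
  rw [k3FormRat_apply]
  simp only [k3Form, Rat.cast_sum, Rat.cast_mul, Rat.cast_intCast]

/-- The rational K3 form restricted to `Λ = ℤ²²` is the integral lattice form. [folklore] -/
theorem k3FormRat_intCast (v w : K3Index → ℤ) :
    k3FormRat (fun i => (v i : ℚ)) (fun i => (w i : ℚ)) =
      ((∑ i, ∑ j, v i * k3Gram i j * w j : ℤ) : ℚ) := by
  rw [k3FormRat_apply]
  simp only [Int.cast_sum, Int.cast_mul]

/-- An integral vector of `Λ_ℂ` is (the image of) a rational one. [folklore] -/
theorem intCast_eq_ratCast_intCast (v : K3Index → ℤ) :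
    (fun i => (v i : ℂ)) = fun i => (((v i : ℚ)) : ℂ) := by
  funext i
  rw [Rat.cast_intCast]

/-- The rational K3 form is symmetric. [folklore] -/
theorem k3FormRat_isSymm : k3FormRat.IsSymm := by
  refine ⟨fun a b => ?_⟩
  apply Rat.cast_injective (α := ℂ)
  rw [← k3Form_ratCast, ← k3Form_ratCast, k3Form_comm]

/-- The complex K3 form is symmetric. [folklore] -/
theorem k3FormC_isSymm : k3FormC.IsSymm :=
  ⟨fun a b => by rw [k3FormC_apply, k3FormC_apply, k3Form_comm]⟩

/-- **The rational K3 form is non-degenerate** (the K3 lattice is unimodular, `det Λ_{K3} = -1`,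
Huybrechts Ch. 14 §0.3 (vi); so Cartan–Dieudonné applies to `O(Λ_ℚ)`).
[cite: Huybrechts2016K3, Ch. 14 §0.3 (vi)] -/
theorem k3FormRat_nondegenerate : k3FormRat.Nondegenerate := by
  refine LinearMap.BilinForm.nondegenerate_toBilin'_of_det_ne_zero' _ ?_
  have h : (k3Gram.map (Int.cast : ℤ → ℚ)).det = ((k3Gram.det : ℤ) : ℚ) := (Int.cast_det k3Gram).symm
  rw [h, k3Gram_det]
  norm_num

/-- `rk Λ_{K3} = 22`. [cite: Huybrechts2016K3, Ch. 1 §3.3] -/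
theorem finrank_k3Rat : Module.finrank ℚ (K3Index → ℚ) = 22 := by
  rw [Module.finrank_fintype_fun_eq_card]
  rfl

/-! ### Reflections along lattice vectors, complexified -/

/-- **The reflection `s_v` along a lattice vector `v ∈ Λ_{K3}`, on `Λ_ℂ`**:
`x ↦ x - (2 (v.x)/(v.v)) v` (the identity if `(v.v) = 0`). For `v` primitive with
`(v.v) = 2d ≠ 0` this is Buskin's basic isometry of `|d|`-cyclic type (§3 Example 3.2);
Huybrechts' `s_b`. [cite: Buskin2019, §3 Example 3.2 and §6.2] [cite: Huybrechts2019, §1.1] -/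
def k3ReflectionC (v : K3Index → ℤ) : Module.End ℂ (K3Index → ℂ) :=
  reflection k3FormC (fun i => (v i : ℂ))

/-- The defining formula of `k3ReflectionC`. [cite: Huybrechts2019, §1.1] -/
theorem k3ReflectionC_apply (v : K3Index → ℤ) (x : K3Index → ℂ) :
    k3ReflectionC v x =
      x - (2 / k3Form (fun i => (v i : ℂ)) (fun i => (v i : ℂ)) * k3Form (fun i => (v i : ℂ)) x) •
        fun i => (v i : ℂ) := by
  rw [k3ReflectionC, reflection_apply, k3FormC_apply, k3FormC_apply]

/-- `s_v` is an isometry of `(Λ_ℂ, k3Form)`. [cite: Huybrechts2019, §1.1] -/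
theorem k3Form_k3ReflectionC (v : K3Index → ℤ) (a b : K3Index → ℂ) :
    k3Form (k3ReflectionC v a) (k3ReflectionC v b) = k3Form a b := by
  have h := isOrthogonal_reflection k3FormC_isSymm (fun i => (v i : ℂ)) a b
  rwa [k3FormC_apply, k3FormC_apply] at h

/-- A product of reflections along lattice vectors is an isometry of `(Λ_ℂ, k3Form)`.
[cite: Huybrechts2019, §1.1] -/
theorem k3Form_prod_k3ReflectionC (l : List (K3Index → ℤ)) (a b : K3Index → ℂ) :
    k3Form ((l.map k3ReflectionC).prod a) ((l.map k3ReflectionC).prod b) = k3Form a b := by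
  have h := isOrthogonal_prod_reflections k3FormC_isSymm (l.map fun v i => (v i : ℂ)) a b
  rw [k3FormC_apply, k3FormC_apply, List.map_map] at h
  exact h

/-- `s_v` is a REAL operator: it commutes with complex conjugation on `Λ_ℂ` (`v ∈ Λ ⊂ Λ_ℝ`).
[cite: Huybrechts2016K3, Ch. 6 §1.1] -/
theorem star_k3ReflectionC (v : K3Index → ℤ) (x : K3Index → ℂ) :
    star (k3ReflectionC v x) = k3ReflectionC v (star x) := by
  have hv : star (fun i => (v i : ℂ)) = fun i => (v i : ℂ) := by
    funext i
    simp only [Pi.star_apply, star_intCast]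
  rw [k3ReflectionC_apply, k3ReflectionC_apply, star_sub, star_smul, hv, star_mul', star_div₀,
    star_k3Form, star_k3Form, hv, star_ofNat]

/-- `s_v` restricted to `Λ_ℚ ⊂ Λ_ℂ` is the rational reflection along `v` for `k3FormRat`: the
complexified reflection is DEFINED OVER `ℚ`. [cite: Huybrechts2019, §1.1] -/
theorem k3ReflectionC_ratCast (v : K3Index → ℤ) (u : K3Index → ℚ) :
    k3ReflectionC v (fun i => (u i : ℂ)) =
      fun i => ((reflection k3FormRat (fun j => (v j : ℚ)) u i : ℚ) : ℂ) := by
  rw [k3ReflectionC_apply, intCast_eq_ratCast_intCast, k3Form_ratCast, k3Form_ratCast]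
  funext i
  simp only [Pi.sub_apply, Pi.smul_apply, smul_eq_mul, reflection_apply, Rat.cast_sub, Rat.cast_mul,
    Rat.cast_div, Rat.cast_ofNat]

/-- The same for a product of reflections. [cite: Huybrechts2019, §1.1] -/
theorem prod_k3ReflectionC_ratCast (l : List (K3Index → ℤ)) (u : K3Index → ℚ) :
    (l.map k3ReflectionC).prod (fun i => (u i : ℂ)) =
      fun i => (((l.map fun v => reflection k3FormRat (fun j => (v j : ℚ))).prod u i : ℚ) : ℂ) := by
  induction l with
  | nil => simp
  | cons v l ih =>
    rw [List.map_cons, List.prod_cons, Module.End.mul_apply, ih, k3ReflectionC_ratCast, List.map_cons,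
      List.prod_cons, Module.End.mul_apply]

/-! ### Clearing denominators: rational vectors have lattice multiples -/

/-- An explicit lattice multiple of a rational vector `n ∈ Λ_ℚ`:
`(∏_{j ≠ i} den nⱼ) · num nᵢ = (∏ⱼ den nⱼ) · nᵢ`. [folklore] -/
def latticeMultiple (n : K3Index → ℚ) : K3Index → ℤ :=
  fun i => (∏ j ∈ Finset.univ.erase i, ((n j).den : ℤ)) * (n i).num

/-- `latticeMultiple n = (∏ⱼ den nⱼ) • n` in `Λ_ℚ`. [folklore] -/
theorem intCast_latticeMultiple (n : K3Index → ℚ) :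
    (fun i => (latticeMultiple n i : ℚ)) = ((∏ j, (n j).den : ℕ) : ℚ) • n := by
  funext i
  simp only [latticeMultiple, Pi.smul_apply, smul_eq_mul, Int.cast_mul, Int.cast_prod,
    Int.cast_natCast, Nat.cast_prod]
  rw [← Finset.prod_erase_mul _ _ (Finset.mem_univ i), mul_assoc, Rat.den_mul_eq_num]

/-- The multiplier `∏ⱼ den nⱼ` is a non-zero natural number. [folklore] -/
theorem prod_den_ne_zero_nat (n : K3Index → ℚ) : (∏ j, (n j).den : ℕ) ≠ 0 :=
  Finset.prod_ne_zero_iff.2 fun j _ => (n j).den_nz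

/-- The multiplier `∏ⱼ den nⱼ` is non-zero in `ℚ`. [folklore] -/
theorem prod_den_ne_zero (n : K3Index → ℚ) : ((∏ j, (n j).den : ℕ) : ℚ) ≠ 0 :=
  Nat.cast_ne_zero.2 (prod_den_ne_zero_nat n)

/-- Reflecting along the lattice multiple is reflecting along the rational vector
(`s_{c n} = s_n`). [cite: Huybrechts2019, §1.1 ("we may assume that all `b_i ∈ Λ_ℚ` are contained in the lattice `Λ`")] -/
theorem reflection_latticeMultiple (n : K3Index → ℚ) :
    reflection k3FormRat (fun i => (latticeMultiple n i : ℚ)) = reflection k3FormRat n := by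
  rw [intCast_latticeMultiple, reflection_smul _ (prod_den_ne_zero n)]

/-- The lattice multiple of a non-isotropic rational vector is non-isotropic. [folklore] -/
theorem latticeMultiple_sq_ne_zero {n : K3Index → ℚ} (hn : k3FormRat n n ≠ 0) :
    ∑ i, ∑ j, latticeMultiple n i * k3Gram i j * latticeMultiple n j ≠ 0 := by
  intro h0
  apply hn
  have h1 := k3FormRat_intCast (latticeMultiple n) (latticeMultiple n)
  rw [h0, Int.cast_zero, intCast_latticeMultiple] at h1
  simp only [map_smul, LinearMap.smul_apply, smul_eq_mul] at h1
  rcases mul_eq_zero.1 h1 with h | h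
  · exact absurd h (prod_den_ne_zero n)
  · rcases mul_eq_zero.1 h with h | h
    · exact absurd h (prod_den_ne_zero n)
    · exact h

/-! ### Step 1: an isometry of `Λ_ℚ` is a product of reflections along lattice vectors -/

/-- A `ℂ`-linear endomorphism of `Λ_ℂ` mapping `Λ` into `Λ_ℚ` is the complexification of a
`ℚ`-linear endomorphism `τ` of `Λ_ℚ` (`σ ∘ ι = ι ∘ τ`, `ι : Λ_ℚ ⊂ Λ_ℂ`). [folklore] -/
theorem exists_ratEnd_of_forall_intCast (σ : Module.End ℂ (K3Index → ℂ))
    (hrat : ∀ v : K3Index → ℤ, ∃ w : K3Index → ℚ, σ (fun i => (v i : ℂ)) = fun i => (w i : ℂ)) :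
    ∃ τ : Module.End ℚ (K3Index → ℚ),
      ∀ u : K3Index → ℚ, σ (fun i => (u i : ℂ)) = fun i => (τ u i : ℂ) := by
  classical
  choose w hw using hrat
  -- `τ` has the columns `w (e_j)`
  refine ⟨Matrix.toLin' (Matrix.of fun i j => w (Pi.single j 1) i), fun u => ?_⟩
  have hu : (fun i => (u i : ℂ)) = ∑ j, (u j : ℂ) • fun i => ((Pi.single j (1 : ℤ) : K3Index → ℤ) i : ℂ) := by
    funext i
    simp only [Finset.sum_apply, Pi.smul_apply, smul_eq_mul, Pi.single_apply, Int.cast_ite,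
      Int.cast_one, Int.cast_zero, mul_ite, mul_one, mul_zero]
    rw [Finset.sum_ite_eq, if_pos (Finset.mem_univ i)]
  rw [hu, map_sum]
  funext i
  simp only [map_smul, hw, Finset.sum_apply, Pi.smul_apply, smul_eq_mul, Matrix.toLin'_apply,
    Matrix.mulVec, dotProduct, Matrix.of_apply, Rat.cast_sum, Rat.cast_mul]
  refine Finset.sum_congr rfl fun j _ => ?_
  ring

/-- **Step 1 (Buskin §6.2 / Huybrechts §1.1, via Cartan–Dieudonné): every rational isometry of
the K3 lattice is a composition of reflections along non-isotropic lattice vectors.** For a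
`ℂ`-linear isometry `σ` of `(Λ_ℂ, k3Form)` defined over `ℚ` (it maps `Λ` into `Λ_ℚ`; e.g.
`σ = η' ∘ φ ∘ η⁻¹` for a rational Hodge isometry `φ` and markings `η, η'`) there are lattice
vectors `v_1, …, v_m ∈ Λ`, `m ≤ 44`, with `(v_i.v_i) ≠ 0` and `σ = s_{v_1} ∘ ⋯ ∘ s_{v_m}`
("The isometry `ϕ` decomposes as a composition of cyclic type isometries, `ϕ = ϕ_k ∘ ⋯ ∘ ϕ_1`
by the Cartan–Dieudonné theorem"; "we may assume that all `b_i ∈ Λ_ℚ` are contained in the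
lattice `Λ`"). [cite: Buskin2019, §6.2, proof of Thm. 1.1] [cite: Huybrechts2019, §1.1] -/
theorem exists_eq_prod_k3ReflectionC (σ : Module.End ℂ (K3Index → ℂ))
    (hσ : ∀ a b, k3Form (σ a) (σ b) = k3Form a b)
    (hrat : ∀ v : K3Index → ℤ, ∃ w : K3Index → ℚ, σ (fun i => (v i : ℂ)) = fun i => (w i : ℂ)) :
    ∃ l : List (K3Index → ℤ), (∀ v ∈ l, ∑ i, ∑ j, v i * k3Gram i j * v j ≠ 0) ∧ l.length ≤ 44 ∧
      σ = (l.map k3ReflectionC).prod := by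
  classical
  obtain ⟨τ, hτ⟩ := exists_ratEnd_of_forall_intCast σ hrat
  -- `τ` is an isometry of `(Λ_ℚ, k3FormRat)`
  have hτo : k3FormRat.IsOrthogonal τ := by
    intro a b
    apply Rat.cast_injective (α := ℂ)
    rw [← k3Form_ratCast, ← k3Form_ratCast, ← hτ a, ← hτ b, hσ]
  -- Cartan–Dieudonné over `ℚ`
  obtain ⟨l₀, hl₀, hlen, hτl⟩ :=
    exists_eq_prod_reflections k3FormRat_isSymm k3FormRat_nondegenerate τ hτo
  refine ⟨l₀.map latticeMultiple, ?_, ?_, ?_⟩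
  · intro v hv
    obtain ⟨n, hn, rfl⟩ := List.mem_map.1 hv
    exact latticeMultiple_sq_ne_zero (hl₀ n hn)
  · rw [List.length_map, finrank_k3Rat] at *
    omega
  · -- both sides are `ℂ`-linear and agree on the rational standard basis
    refine (Pi.basisFun ℂ K3Index).ext fun j => ?_
    have hj : (Pi.basisFun ℂ K3Index) j = fun i => ((Pi.single j (1 : ℚ) : K3Index → ℚ) i : ℂ) := by
      rw [Pi.basisFun_apply]
      funext i
      by_cases hij : i = j
      · subst hij
        simp only [Pi.single_eq_same, Rat.cast_one]
      · simp only [Pi.single_apply, if_neg hij, Rat.cast_zero]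
    have hmaps : l₀.map ((fun v => reflection k3FormRat fun j => (v j : ℚ)) ∘ latticeMultiple) =
        l₀.map (reflection k3FormRat) :=
      List.map_congr_left fun n _ => by simp only [Function.comp_apply, reflection_latticeMultiple]
    rw [hj, hτ, prod_k3ReflectionC_ratCast, List.map_map, hmaps, hτl]

/-- The complexification of `latticeMultiple n = (∏ⱼ den nⱼ) • n`. [folklore] -/
theorem intCastC_latticeMultiple (n : K3Index → ℚ) :
    (fun i => (latticeMultiple n i : ℂ)) = ((∏ j, (n j).den : ℕ) : ℂ) • fun i => (n i : ℂ) := by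
  funext i
  have h := congrFun (intCast_latticeMultiple n) i
  simp only [Pi.smul_apply, smul_eq_mul] at h ⊢
  rw [← Rat.cast_intCast (α := ℂ), h, Rat.cast_mul, Rat.cast_natCast]

/-- **Clearing denominators in `x^⊥`**: a positive RATIONAL vector orthogonal to `y ∈ Λ_ℂ` has a
positive LATTICE multiple orthogonal to `y` (the projectivity hypothesis of the surjectivity fact
asks for a lattice vector). [cite: Huybrechts2016K3, Ch. 1 §3 (projectivity criterion) and Ch. 6 Rem. 3.3] -/
theorem exists_lattice_pos_orthogonal {y : K3Index → ℂ} {n : K3Index → ℚ}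
    (hy : k3Form (fun i => (n i : ℂ)) y = 0) (hn : 0 < k3FormRat n n) :
    ∃ w : K3Index → ℤ, k3Form (fun i => (w i : ℂ)) y = 0 ∧ 0 < ∑ i, ∑ j, w i * k3Gram i j * w j := by
  refine ⟨latticeMultiple n, ?_, ?_⟩
  · rw [intCastC_latticeMultiple, k3Form_smul_left, hy, mul_zero]
  · have h2 : ((∑ i, ∑ j, latticeMultiple n i * k3Gram i j * latticeMultiple n j : ℤ) : ℚ) =
        ((∏ j, (n j).den : ℕ) : ℚ) * ((∏ j, (n j).den : ℕ) : ℚ) * k3FormRat n n := by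
      rw [← k3FormRat_intCast, intCast_latticeMultiple]
      simp only [map_smul, LinearMap.smul_apply, smul_eq_mul]
      ring
    have h3 : (0 : ℚ) < ((∏ j, (n j).den : ℕ) : ℚ) :=
      lt_of_le_of_ne (Nat.cast_nonneg _) (prod_den_ne_zero n).symm
    exact Int.cast_pos.1 (h2 ▸ mul_pos (mul_pos h3 h3) hn)

/-! ### Step 2: the hypotheses of the projective surjectivity fact propagate along reflections -/

/-- **Step 2 (one reflection).** If `x ∈ Λ_ℂ` satisfies the hypotheses of
`Huybrechts_K3_periodSurjective_projective` (`(x.x) = 0`, `(x̄.x) > 0`, and some lattice vector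
`u ∈ x^⊥` has `(u.u) > 0` — the period of a marked PROJECTIVE K3 surface), then so does `s_v(x)`
for every lattice vector `v`: `s_v` is a real isometry, and `s_v(u) ∈ s_v(x)^⊥` is a positive
RATIONAL vector, a positive multiple of which lies in `Λ`. This is why the intermediate marked K3
surfaces `(S_i, η_i)` of Buskin's chain exist and are projective, as his Prop. 6.2 requires.
[cite: Buskin2019, §6.2, proof of Thm. 1.1] [cite: Huybrechts2016K3, Ch. 6 Rem. 3.3 and Ch. 1 §3 (projectivity criterion)] -/
theorem k3PeriodHypotheses_k3ReflectionC (v : K3Index → ℤ) {x : K3Index → ℂ}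
    (hxx : k3Form x x = 0) (hpos : 0 < (k3Form (star x) x).re)
    (hu : ∃ u : K3Index → ℤ, k3Form (fun i => (u i : ℂ)) x = 0 ∧
      0 < ∑ i, ∑ j, u i * k3Gram i j * u j) :
    k3Form (k3ReflectionC v x) (k3ReflectionC v x) = 0 ∧
      0 < (k3Form (star (k3ReflectionC v x)) (k3ReflectionC v x)).re ∧
      ∃ u : K3Index → ℤ, k3Form (fun i => (u i : ℂ)) (k3ReflectionC v x) = 0 ∧
        0 < ∑ i, ∑ j, u i * k3Gram i j * u j := by
  refine ⟨by rw [k3Form_k3ReflectionC, hxx], by rw [star_k3ReflectionC, k3Form_k3ReflectionC]; exact hpos,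
    ?_⟩
  obtain ⟨u, hux, huu⟩ := hu
  -- the positive rational vector `s_v(u) ∈ s_v(x)^⊥`, then clear denominators
  refine exists_lattice_pos_orthogonal (n := reflection k3FormRat (fun j => (v j : ℚ)) fun j => (u j : ℚ))
    ?_ ?_
  · rw [← k3ReflectionC_ratCast, ← intCast_eq_ratCast_intCast, k3Form_k3ReflectionC, hux]
  · rw [isOrthogonal_reflection k3FormRat_isSymm, k3FormRat_intCast]
    exact Int.cast_pos.2 huu

/-- **Step 2 (a chain of reflections).** The hypotheses of the projective surjectivity fact
propagate along any product of reflections along lattice vectors.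
[cite: Buskin2019, §6.2, proof of Thm. 1.1] -/
theorem k3PeriodHypotheses_prod_k3ReflectionC (l : List (K3Index → ℤ)) {x : K3Index → ℂ}
    (hxx : k3Form x x = 0) (hpos : 0 < (k3Form (star x) x).re)
    (hu : ∃ u : K3Index → ℤ, k3Form (fun i => (u i : ℂ)) x = 0 ∧
      0 < ∑ i, ∑ j, u i * k3Gram i j * u j) :
    k3Form ((l.map k3ReflectionC).prod x) ((l.map k3ReflectionC).prod x) = 0 ∧
      0 < (k3Form (star ((l.map k3ReflectionC).prod x)) ((l.map k3ReflectionC).prod x)).re ∧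
      ∃ u : K3Index → ℤ, k3Form (fun i => (u i : ℂ)) ((l.map k3ReflectionC).prod x) = 0 ∧
        0 < ∑ i, ∑ j, u i * k3Gram i j * u j := by
  induction l with
  | nil =>
    simp only [List.map_nil, List.prod_nil, Module.End.one_apply]
    exact ⟨hxx, hpos, hu⟩
  | cons v l ih =>
    obtain ⟨h1, h2, h3⟩ := ih
    rw [List.map_cons, List.prod_cons, Module.End.mul_apply]
    exact k3PeriodHypotheses_k3ReflectionC v h1 h2 h3

/-- Consecutive intermediate periods differ by ONE reflection: with `σ = s_{v_1} ∘ ⋯ ∘ s_{v_m}`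
and `l_k := s_{v_{k+1}} ∘ ⋯ ∘ s_{v_m}(x)` one has `l_k = s_{v_{k+1}}(l_{k+1})` (Buskin's
`l_i = ϕ̃_i(l_{i-1})`, read from the right end of the list). [cite: Buskin2019, §6.2, proof of Thm. 1.1] -/
theorem prod_k3ReflectionC_drop (l : List (K3Index → ℤ)) {k : ℕ} (hk : k < l.length)
    (x : K3Index → ℂ) :
    ((l.drop k).map k3ReflectionC).prod x =
      k3ReflectionC l[k] (((l.drop (k + 1)).map k3ReflectionC).prod x) := by
  rw [List.drop_eq_getElem_cons hk, List.map_cons, List.prod_cons, Module.End.mul_apply]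

/-! ### Markings: rational classes, and the rational isometry `σ = η ∘ φ ∘ η'⁻¹` induced by a
rational Hodge isometry `φ` via markings `η, η'` (Buskin: "inducing via markings `η, η'` an isometry
`ϕ : Λ_ℚ → Λ_ℚ`") -/

section Marking

variable {S S' : Motives.SchemeOver ℂ}

/-- **Under a marking, rational classes are exactly `Λ_ℚ`.** If `η : H²(S(ℂ); ℂ) ≅ Λ_ℂ`
identifies the integral classes with `Λ = ℤ²²` (a marking in the sense of
`Huybrechts_K3_periodSurjective_projective`), then it identifies the rational classes with
`Λ_ℚ = ℚ²²` — rational classes have integral multiples (`IsRationalClass.exists_nsmul_isIntegralClass`,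
`S` smooth projective) and rational multiples of integral classes are rational.
[cite: Huybrechts2016K3, Ch. 6 Rem. 3.3 (markings) and Ch. 1 §3.3] -/
theorem isRationalClass_iff_of_marking (hS : IsK3Surface S)
    (η : HodgeTheory.complexBetti S (2 * 1) ≃ₗ[ℂ] (K3Index → ℂ))
    (hη : ∀ c : HodgeTheory.complexBetti S (2 * 1),
      HodgeTheory.IsIntegralClass c ↔ ∃ v : K3Index → ℤ, η c = fun i => (v i : ℂ))
    (c : HodgeTheory.complexBetti S (2 * 1)) :
    HodgeTheory.IsRationalClass c ↔ ∃ w : K3Index → ℚ, η c = fun i => (w i : ℂ) := by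
  constructor
  · intro hc
    obtain ⟨N, hN, hNc⟩ := hc.exists_nsmul_isIntegralClass hS.1
    obtain ⟨v, hv⟩ := (hη _).1 hNc
    refine ⟨fun i => (v i : ℚ) / N, ?_⟩
    have hN' : (N : ℂ) ≠ 0 := Nat.cast_ne_zero.2 hN.ne'
    rw [map_smul] at hv
    funext i
    have hi : (N : ℂ) * η c i = (v i : ℂ) := by
      have := congrFun hv i
      simpa only [Pi.smul_apply, smul_eq_mul] using this
    rw [Rat.cast_div, Rat.cast_intCast, Rat.cast_natCast, ← hi]
    field_simp
  · rintro ⟨w, hw⟩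
    have hint : HodgeTheory.IsIntegralClass (η.symm fun i => (latticeMultiple w i : ℂ)) :=
      (hη _).2 ⟨latticeMultiple w, η.apply_symm_apply _⟩
    have hd : ((∏ j, (w j).den : ℕ) : ℂ) ≠ 0 := Nat.cast_ne_zero.2 (prod_den_ne_zero_nat w)
    have hc : c = ((((∏ j, (w j).den : ℕ) : ℚ)⁻¹ : ℚ) : ℂ) •
        η.symm (fun i => (latticeMultiple w i : ℂ)) := by
      apply η.injective
      rw [map_smul, η.apply_symm_apply, intCastC_latticeMultiple, smul_smul, ← hw, Rat.cast_inv,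
        Rat.cast_natCast, inv_mul_cancel₀ hd, one_smul]
    rw [hc]
    exact hint.isRationalClass.smul _

/-- **The isometry induced via markings is defined over `ℚ`.** For markings `η` of `S` and `η'`
of `S'` (integral classes `↔ Λ`) and a `ℂ`-linear `φ : H²(S'(ℂ); ℂ) → H²(S(ℂ); ℂ)` mapping
rational classes to rational classes (the rationality hypothesis of
`Buskin2019_hodgeIsometry_algebraic`), the conjugate `σ = η ∘ φ ∘ η'⁻¹ : Λ_ℂ → Λ_ℂ` maps `Λ`
into `Λ_ℚ` (Buskin: "`φ : H²(S, ℚ) → H²(S', ℚ)` inducing via markings `η, η'` an isometry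
`ϕ : Λ_ℚ → Λ_ℚ`"). [cite: Buskin2019, §6.2, proof of Thm. 1.1] -/
theorem markingConj_intCast (hS : IsK3Surface S)
    (η : HodgeTheory.complexBetti S (2 * 1) ≃ₗ[ℂ] (K3Index → ℂ))
    (hη : ∀ c : HodgeTheory.complexBetti S (2 * 1),
      HodgeTheory.IsIntegralClass c ↔ ∃ v : K3Index → ℤ, η c = fun i => (v i : ℂ))
    (η' : HodgeTheory.complexBetti S' (2 * 1) ≃ₗ[ℂ] (K3Index → ℂ))
    (hη' : ∀ c : HodgeTheory.complexBetti S' (2 * 1),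
      HodgeTheory.IsIntegralClass c ↔ ∃ v : K3Index → ℤ, η' c = fun i => (v i : ℂ))
    (φ : HodgeTheory.complexBetti S' (2 * 1) →ₗ[ℂ] HodgeTheory.complexBetti S (2 * 1))
    (hφ : ∀ x, HodgeTheory.IsRationalClass x → HodgeTheory.IsRationalClass (φ x))
    (v : K3Index → ℤ) :
    ∃ w : K3Index → ℚ,
      (η.toLinearMap ∘ₗ φ ∘ₗ η'.symm.toLinearMap) (fun i => (v i : ℂ)) = fun i => (w i : ℂ) := by
  have hint : HodgeTheory.IsIntegralClass (η'.symm fun i => (v i : ℂ)) :=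
    (hη' _).2 ⟨v, η'.apply_symm_apply _⟩
  obtain ⟨w, hw⟩ := (isRationalClass_iff_of_marking hS η hη _).1 (hφ _ hint.isRationalClass)
  exact ⟨w, by simpa only [LinearMap.coe_comp, LinearEquiv.coe_coe, Function.comp_apply] using hw⟩

/-- **The isometry induced via markings is an isometry of `(Λ_ℂ, k3Form)`.** With markings whose
cup-product formulas `a ∪ b = (ηa.ηb) p`, `a ∪ b = (η'a.η'b) p'` use the SAME integral generators
`p ≠ 0`, `p'` of `H⁴` as the isometry hypothesis `(x.y) = a p' ⟹ (φx.φy) = a p` of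
`Buskin2019_hodgeIsometry_algebraic`, the conjugate `σ = η ∘ φ ∘ η'⁻¹` preserves the K3 form.
(The generator `p` must be non-zero for the multiplier `a` to be determined; for an actual K3
surface `H⁴(S(ℂ); ℤ) ≅ ℤ ≠ 0`.) [cite: Buskin2019, §6.2, proof of Thm. 1.1] -/
theorem k3Form_markingConj
    (η : HodgeTheory.complexBetti S (2 * 1) ≃ₗ[ℂ] (K3Index → ℂ))
    (p : HodgeTheory.complexBetti S (2 * 2)) (hp : p ≠ 0)
    (hηcup : ∀ a b : HodgeTheory.complexBetti S (2 * 1),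
      cupProduct (rfl : 2 * 1 + 2 * 1 = 2 * 2) a b = k3Form (η a) (η b) • p)
    (η' : HodgeTheory.complexBetti S' (2 * 1) ≃ₗ[ℂ] (K3Index → ℂ))
    (p' : HodgeTheory.complexBetti S' (2 * 2))
    (hη'cup : ∀ a b : HodgeTheory.complexBetti S' (2 * 1),
      cupProduct (rfl : 2 * 1 + 2 * 1 = 2 * 2) a b = k3Form (η' a) (η' b) • p')
    (φ : HodgeTheory.complexBetti S' (2 * 1) →ₗ[ℂ] HodgeTheory.complexBetti S (2 * 1))
    (hφ : ∀ (x y : HodgeTheory.complexBetti S' (2 * 1)) (a : ℂ),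
      cupProduct (rfl : 2 * 1 + 2 * 1 = 2 * 2) x y = a • p' →
        cupProduct (rfl : 2 * 1 + 2 * 1 = 2 * 2) (φ x) (φ y) = a • p)
    (a b : K3Index → ℂ) :
    k3Form ((η.toLinearMap ∘ₗ φ ∘ₗ η'.symm.toLinearMap) a)
      ((η.toLinearMap ∘ₗ φ ∘ₗ η'.symm.toLinearMap) b) = k3Form a b := by
  have h1 : cupProduct (rfl : 2 * 1 + 2 * 1 = 2 * 2) (η'.symm a) (η'.symm b) = k3Form a b • p' := by
    rw [hη'cup, η'.apply_symm_apply, η'.apply_symm_apply]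
  have h2 := hφ _ _ _ h1
  rw [hηcup] at h2
  have h3 := sub_eq_zero.2 h2
  rw [← sub_smul, smul_eq_zero, sub_eq_zero] at h3
  rcases h3 with h3 | h3
  · simpa only [LinearMap.coe_comp, LinearEquiv.coe_coe, Function.comp_apply] using h3
  · exact absurd h3 hp

end Marking

/-! ### Assembly: the chain of marked projective K3 surfaces along a rational isometry -/

/-- **Buskin's chain of marked K3 surfaces (§6.2, proof of Thm. 1.1, first paragraph;
Huybrechts 2019 §1.1).** Granted the surjectivity of the period map in its projective form (the
tree's named fact `Huybrechts_K3_periodSurjective_projective`, hypothesis `h`): for every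
isometry `σ` of `(Λ_ℂ, k3Form)` defined over `ℚ` and every period vector `x` of a marked
projective K3 surface (`(x.x) = 0`, `(x̄.x) > 0`, a positive lattice vector in `x^⊥`), there are
non-isotropic lattice vectors `v_1, …, v_m` (`m ≤ 44`) with `σ = s_{v_1} ∘ ⋯ ∘ s_{v_m}`, and for
EVERY `k` the intermediate period `l = s_{v_{k+1}} ∘ ⋯ ∘ s_{v_m}(x)` (`l = x` for `k ≥ m`,
`l = σ x` for `k = 0`) is realised by a marked algebraic K3 surface `(S_k, η_k)`: an
`IsK3Surface S_k` with a marking `η_k : H²(S_k(ℂ); ℂ) ≅ Λ_ℂ` (integral classes `↔ Λ`, cup product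
`=` lattice form times an integral generator `p_k` of `H⁴`) under which `η_k⁻¹(l)` is of type
`(2,0)` and spans `H^{2,0}(S_k)` — "we obtain a sequence of marked K3 surfaces
`(S, η), (S_1, η_1), …, (S_{k-1}, η_{k-1}), (S', η')` with periods `l_i = ϕ̃_i ∘ ⋯ ∘ ϕ̃_1([η(σ_S)])`".
(The consecutive Hodge isometries `ψ_i = η_{i+1}⁻¹ ϕ_{i+1} η_i` are then of cyclic/reflective type;
their algebraicity, Buskin Prop. 6.2 / Huybrechts Thm. 1.1, is not formalised in the tree.)
[cite: Buskin2019, §6.2, proof of Thm. 1.1] [cite: Huybrechts2019, §1.1] [cite: Huybrechts2016K3, Ch. 6 Rem. 3.3] -/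
theorem exists_markedK3Chain (h : Huybrechts_K3_periodSurjective_projective)
    (σ : Module.End ℂ (K3Index → ℂ)) (hσ : ∀ a b, k3Form (σ a) (σ b) = k3Form a b)
    (hrat : ∀ v : K3Index → ℤ, ∃ w : K3Index → ℚ, σ (fun i => (v i : ℂ)) = fun i => (w i : ℂ))
    {x : K3Index → ℂ} (hxx : k3Form x x = 0) (hpos : 0 < (k3Form (star x) x).re)
    (hu : ∃ u : K3Index → ℤ, k3Form (fun i => (u i : ℂ)) x = 0 ∧
      0 < ∑ i, ∑ j, u i * k3Gram i j * u j) :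
    ∃ l : List (K3Index → ℤ), (∀ v ∈ l, ∑ i, ∑ j, v i * k3Gram i j * v j ≠ 0) ∧ l.length ≤ 44 ∧
      σ = (l.map k3ReflectionC).prod ∧
      ∀ k : ℕ, ∃ (S : Motives.SchemeOver ℂ) (_ : IsK3Surface S)
        (φ : HodgeTheory.complexBetti S (2 * 1) ≃ₗ[ℂ] (K3Index → ℂ))
        (p : HodgeTheory.complexBetti S (2 * 2)),
        HodgeTheory.IsIntegralClass p ∧
        (∀ q : HodgeTheory.complexBetti S (2 * 2), HodgeTheory.IsIntegralClass q → ∃ n : ℤ, q = n • p) ∧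
        (∀ c : HodgeTheory.complexBetti S (2 * 1),
            HodgeTheory.IsIntegralClass c ↔ ∃ v : K3Index → ℤ, φ c = fun i => (v i : ℂ)) ∧
        (∀ a b : HodgeTheory.complexBetti S (2 * 1),
            cupProduct (rfl : 2 * 1 + 2 * 1 = 2 * 2) a b = k3Form (φ a) (φ b) • p) ∧
        HodgeTheory.IsOfHodgeType 2 S (2 * 1) 2 0 (φ.symm (((l.drop k).map k3ReflectionC).prod x)) ∧
        (∀ τ : HodgeTheory.complexBetti S (2 * 1),
            HodgeTheory.IsOfHodgeType 2 S (2 * 1) 2 0 τ →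
              ∃ t : ℂ, τ = t • φ.symm (((l.drop k).map k3ReflectionC).prod x)) := by
  obtain ⟨l, hl, hlen, hσl⟩ := exists_eq_prod_k3ReflectionC σ hσ hrat
  refine ⟨l, hl, hlen, hσl, fun k => ?_⟩
  obtain ⟨h1, h2, h3⟩ := k3PeriodHypotheses_prod_k3ReflectionC (l.drop k) hxx hpos hu
  exact h _ h1 h2 h3

/-- **The first paragraph of Buskin's proof of Thm. 1.1, for the data of
`Buskin2019_hodgeIsometry_algebraic`.** Granted the projective surjectivity fact (`h`): for K3
surfaces `S, S'`, a `ℂ`-linear `φ : H²(S'(ℂ); ℂ) → H²(S(ℂ); ℂ)` which is rational and isometric in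
the sense of that statement (`(x.y) = a p' ⟹ (φx.φy) = a p`, `p ≠ 0`), markings `η, η'` of `S, S'`
(integral classes `↔ Λ`, cup product `=` K3 form times the same generators `p, p'`), and a period
vector `x` of the marked projective surface `(S', η')` (any `x` satisfying the hypotheses of the
surjectivity fact), the induced isometry `σ = η ∘ φ ∘ η'⁻¹` of `Λ_ℚ` is a product
`s_{v_1} ∘ ⋯ ∘ s_{v_m}` (`m ≤ 44`) of reflections along non-isotropic lattice vectors and every
intermediate period `s_{v_{k+1}} ∘ ⋯ ∘ s_{v_m}(x)` is the period of a marked algebraic K3 surface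
`(S_k, η_k)` — "we obtain a sequence of marked K3 surfaces `(S, η), (S_1, η_1), …, (S', η')` with
periods `l_i = ϕ̃_i ∘ ⋯ ∘ ϕ̃_1([η(σ_S)])`". What is NOT here (and not in the tree): that the period
`η'(σ_{S'})` of an actual K3 surface satisfies these hypotheses (Hodge–Riemann for `H²` of a K3),
the existence of markings of the GIVEN `S, S'` (`H²(K3, ℤ) ≅ Λ_{K3}`, Huybrechts Ch. 1 Prop. 3.5),
and the algebraicity of the consecutive reflective Hodge isometries (Buskin Prop. 6.2).
[cite: Buskin2019, §6.2, proof of Thm. 1.1] [cite: Huybrechts2019, §1.1] -/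
theorem exists_markedK3Chain_of_marking (h : Huybrechts_K3_periodSurjective_projective)
    {S S' : Motives.SchemeOver ℂ} (hS : IsK3Surface S)
    (η : HodgeTheory.complexBetti S (2 * 1) ≃ₗ[ℂ] (K3Index → ℂ))
    (p : HodgeTheory.complexBetti S (2 * 2)) (hp : p ≠ 0)
    (hη : ∀ c : HodgeTheory.complexBetti S (2 * 1),
      HodgeTheory.IsIntegralClass c ↔ ∃ v : K3Index → ℤ, η c = fun i => (v i : ℂ))
    (hηcup : ∀ a b : HodgeTheory.complexBetti S (2 * 1),
      cupProduct (rfl : 2 * 1 + 2 * 1 = 2 * 2) a b = k3Form (η a) (η b) • p)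
    (η' : HodgeTheory.complexBetti S' (2 * 1) ≃ₗ[ℂ] (K3Index → ℂ))
    (p' : HodgeTheory.complexBetti S' (2 * 2))
    (hη' : ∀ c : HodgeTheory.complexBetti S' (2 * 1),
      HodgeTheory.IsIntegralClass c ↔ ∃ v : K3Index → ℤ, η' c = fun i => (v i : ℂ))
    (hη'cup : ∀ a b : HodgeTheory.complexBetti S' (2 * 1),
      cupProduct (rfl : 2 * 1 + 2 * 1 = 2 * 2) a b = k3Form (η' a) (η' b) • p')
    (φ : HodgeTheory.complexBetti S' (2 * 1) →ₗ[ℂ] HodgeTheory.complexBetti S (2 * 1))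
    (hφrat : ∀ x, HodgeTheory.IsRationalClass x → HodgeTheory.IsRationalClass (φ x))
    (hφiso : ∀ (x y : HodgeTheory.complexBetti S' (2 * 1)) (a : ℂ),
      cupProduct (rfl : 2 * 1 + 2 * 1 = 2 * 2) x y = a • p' →
        cupProduct (rfl : 2 * 1 + 2 * 1 = 2 * 2) (φ x) (φ y) = a • p)
    {x : K3Index → ℂ} (hxx : k3Form x x = 0) (hpos : 0 < (k3Form (star x) x).re)
    (hu : ∃ u : K3Index → ℤ, k3Form (fun i => (u i : ℂ)) x = 0 ∧
      0 < ∑ i, ∑ j, u i * k3Gram i j * u j) :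
    ∃ l : List (K3Index → ℤ), (∀ v ∈ l, ∑ i, ∑ j, v i * k3Gram i j * v j ≠ 0) ∧ l.length ≤ 44 ∧
      η.toLinearMap ∘ₗ φ ∘ₗ η'.symm.toLinearMap = (l.map k3ReflectionC).prod ∧
      ∀ k : ℕ, ∃ (T : Motives.SchemeOver ℂ) (_ : IsK3Surface T)
        (ψ : HodgeTheory.complexBetti T (2 * 1) ≃ₗ[ℂ] (K3Index → ℂ))
        (q : HodgeTheory.complexBetti T (2 * 2)),
        HodgeTheory.IsIntegralClass q ∧
        (∀ r : HodgeTheory.complexBetti T (2 * 2), HodgeTheory.IsIntegralClass r → ∃ n : ℤ, r = n • q) ∧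
        (∀ c : HodgeTheory.complexBetti T (2 * 1),
            HodgeTheory.IsIntegralClass c ↔ ∃ v : K3Index → ℤ, ψ c = fun i => (v i : ℂ)) ∧
        (∀ a b : HodgeTheory.complexBetti T (2 * 1),
            cupProduct (rfl : 2 * 1 + 2 * 1 = 2 * 2) a b = k3Form (ψ a) (ψ b) • q) ∧
        HodgeTheory.IsOfHodgeType 2 T (2 * 1) 2 0 (ψ.symm (((l.drop k).map k3ReflectionC).prod x)) ∧
        (∀ τ : HodgeTheory.complexBetti T (2 * 1),
            HodgeTheory.IsOfHodgeType 2 T (2 * 1) 2 0 τ →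
              ∃ t : ℂ, τ = t • ψ.symm (((l.drop k).map k3ReflectionC).prod x)) :=
  exists_markedK3Chain h _ (k3Form_markingConj η p hp hηcup η' p' hη'cup φ hφiso)
    (markingConj_intCast hS η hη η' hη' φ hφrat) hxx hpos hu

/-! ### No anti-isometries of `Λ_ℚ` (signature), and the sign of the generators of `H⁴` -/

/-- The rational K3 form is NEGATIVE DEFINITE on the `E₈(−1)^{⊕2}`-block of `Λ_ℚ` (the vectors
with vanishing `U^{⊕3}`-coordinates): clear denominators and use `k3Lattice_neg_of_antidiag`.
[cite: Huybrechts2016K3, Ch. 14 §0.3 (iii), (vi)] -/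
theorem k3FormRat_self_neg_of_inr_eq_zero {v : K3Index → ℚ} (hv : ∀ k, v (Sum.inr k) = 0)
    (hv0 : v ≠ 0) : k3FormRat v v < 0 := by
  have hD : (0 : ℚ) < ((∏ j, (v j).den : ℕ) : ℚ) :=
    lt_of_le_of_ne (Nat.cast_nonneg _) (prod_den_ne_zero v).symm
  have hw : ∀ k, latticeMultiple v (Sum.inr k) = 0 := fun k => by
    have h := congrFun (intCast_latticeMultiple v) (Sum.inr k)
    simp only [Pi.smul_apply, smul_eq_mul, hv k, mul_zero, Int.cast_eq_zero] at h
    exact h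
  have hw0 : latticeMultiple v ≠ 0 := by
    intro h0
    apply hv0
    funext i
    have h := congrFun (intCast_latticeMultiple v) i
    rw [h0] at h
    simp only [Pi.zero_apply, Int.cast_zero, Pi.smul_apply, smul_eq_mul] at h
    rcases mul_eq_zero.1 h.symm with h | h
    · exact absurd h (prod_den_ne_zero v)
    · rw [h, Pi.zero_apply]
  have hneg := k3Lattice_neg_of_antidiag (v := latticeMultiple v)
    (by rw [hw, hw, neg_zero]) (by rw [hw, hw, neg_zero]) (by rw [hw, hw, neg_zero]) hw0
  have h2 : k3FormRat (fun i => (latticeMultiple v i : ℚ)) (fun i => (latticeMultiple v i : ℚ)) =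
      ((∏ j, (v j).den : ℕ) : ℚ) * ((∏ j, (v j).den : ℕ) : ℚ) * k3FormRat v v := by
    rw [intCast_latticeMultiple]
    simp only [map_smul, LinearMap.smul_apply, smul_eq_mul]
    ring
  rw [k3FormRat_intCast] at h2
  have h3 : ((∏ j, (v j).den : ℕ) : ℚ) * ((∏ j, (v j).den : ℕ) : ℚ) * k3FormRat v v < 0 := by
    rw [← h2]
    exact_mod_cast hneg
  nlinarith [mul_pos hD hD]

/-- **`Λ_ℚ` has no anti-isometry** (Sylvester's law of inertia: the signature `(3, 19)` of
`Λ_{K3}` is not symmetric). A `ℚ`-linear `τ` with `(τa.τb) = -(a.b)` would be injective and carry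
the `16`-dimensional negative definite block `E₈(−1)^{⊕2} ⊗ ℚ` onto a positive definite subspace
meeting it trivially, forcing `16 + 16 ≤ 22`. This is why the choice of signs of the generators
`p, p'` of `H⁴` in `Buskin2019_hodgeIsometry_algebraic` is immaterial: opposite signs make its
isometry hypothesis vacuous. [cite: Huybrechts2016K3, Ch. 1 Prop. 3.5 and Ch. 14 §0.3 (vi) (signature `(3,19)`)] -/
theorem not_antiIsometry_k3FormRat (τ : Module.End ℚ (K3Index → ℚ))
    (hτ : ∀ a b, k3FormRat (τ a) (τ b) = -k3FormRat a b) : False := by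
  classical
  -- the `E₈ ⊕ E₈` block `N = ker (v ↦ v|_U)`
  let π : (K3Index → ℚ) →ₗ[ℚ] (Fin 2 ⊕ (Fin 2 ⊕ Fin 2) → ℚ) := LinearMap.funLeft ℚ ℚ Sum.inr
  let N : Submodule ℚ (K3Index → ℚ) := LinearMap.ker π
  have hNmem : ∀ v ∈ N, ∀ k, v (Sum.inr k) = 0 := fun v hv k => by
    have h := LinearMap.mem_ker.1 hv
    exact congrFun h k
  have hNneg : ∀ v ∈ N, v ≠ 0 → k3FormRat v v < 0 := fun v hv hv0 =>
    k3FormRat_self_neg_of_inr_eq_zero (hNmem v hv) hv0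
  have hπsurj : Function.Surjective π :=
    LinearMap.funLeft_surjective_of_injective ℚ ℚ Sum.inr Sum.inr_injective
  have hrange : Module.finrank ℚ (LinearMap.range π) = 6 := by
    rw [LinearMap.range_eq_top.2 hπsurj, finrank_top, Module.finrank_fintype_fun_eq_card]
    rfl
  have hN : Module.finrank ℚ N = 16 := by
    have h := LinearMap.finrank_range_add_finrank_ker π
    rw [hrange, finrank_k3Rat] at h
    simpa using (by omega : Module.finrank ℚ (LinearMap.ker π) = 16)
  -- `τ` is injective (an anti-isometry of a non-degenerate form)
  have hτinj : Function.Injective τ := by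
    rw [← LinearMap.ker_eq_bot, Submodule.eq_bot_iff]
    intro v hv
    rw [LinearMap.mem_ker] at hv
    refine k3FormRat_nondegenerate.1 v fun w => ?_
    have h := hτ v w
    rw [hv, LinearMap.map_zero, LinearMap.zero_apply] at h
    linarith
  -- its image of `N` is positive definite of dimension `16`
  let M : Submodule ℚ (K3Index → ℚ) := N.map τ
  have hM : Module.finrank ℚ M = 16 := by
    rw [← hN]
    exact (LinearEquiv.finrank_eq (Submodule.equivMapOfInjective τ hτinj N)).symm
  have hMpos : ∀ m ∈ M, m ≠ 0 → 0 < k3FormRat m m := by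
    intro m hm hm0
    obtain ⟨v, hv, rfl⟩ := Submodule.mem_map.1 hm
    have hv0 : v ≠ 0 := fun h => hm0 (by rw [h, LinearMap.map_zero])
    rw [hτ]
    linarith [hNneg v hv hv0]
  have hinf : N ⊓ M = ⊥ := by
    rw [Submodule.eq_bot_iff]
    intro w hw
    by_contra hw0
    have h1 := hNneg w hw.1 hw0
    have h2 := hMpos w hw.2 hw0
    linarith
  have hsum := Submodule.finrank_sup_add_finrank_inf_eq N M
  rw [hinf, finrank_bot, hN, hM] at hsum
  have hle : Module.finrank ℚ ↥(N ⊔ M) ≤ Module.finrank ℚ (K3Index → ℚ) := Submodule.finrank_le _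
  rw [finrank_k3Rat] at hle
  omega

/-- The complexified version: there is no `ℂ`-linear anti-isometry of `(Λ_ℂ, k3Form)` defined
over `ℚ` (mapping `Λ` into `Λ_ℚ`). [cite: Huybrechts2016K3, Ch. 14 §0.3 (vi)] -/
theorem not_antiIsometry_k3Form (σ : Module.End ℂ (K3Index → ℂ))
    (hσ : ∀ a b, k3Form (σ a) (σ b) = -k3Form a b)
    (hrat : ∀ v : K3Index → ℤ, ∃ w : K3Index → ℚ, σ (fun i => (v i : ℂ)) = fun i => (w i : ℂ)) :
    False := by
  obtain ⟨τ, hτ⟩ := exists_ratEnd_of_forall_intCast σ hrat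
  refine not_antiIsometry_k3FormRat τ fun a b => ?_
  apply Rat.cast_injective (α := ℂ)
  rw [Rat.cast_neg, ← k3Form_ratCast, ← k3Form_ratCast, ← hτ a, ← hτ b, hσ]

/-- Two integral generators of the same line agree up to sign: in a `ℂ`-vector space, if `q ≠ 0`,
`q ∈ ℤ p` and `p ∈ ℤ q`, then `p = q` or `p = -q` (the two generators `±[pt]` of
`H⁴(S(ℂ); ℤ) ≅ ℤ`). [folklore] -/
theorem eq_or_eq_neg_of_zsmul {M : Type*} [AddCommGroup M] [Module ℂ M] {p q : M} (hq : q ≠ 0)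
    (h₁ : ∃ n : ℤ, q = n • p) (h₂ : ∃ n : ℤ, p = n • q) : p = q ∨ p = -q := by
  obtain ⟨n, hn⟩ := h₁
  obtain ⟨n', hn'⟩ := h₂
  have h : (n * n') • q = q := by rw [mul_smul, ← hn', ← hn]
  have h0 : (((n * n' - 1 : ℤ)) : ℂ) • q = 0 := by
    rw [Int.cast_smul_eq_zsmul, sub_smul, h, one_smul, sub_self]
  rcases smul_eq_zero.1 h0 with h0 | h0
  · have h1 : n * n' = 1 := by
      have := Int.cast_eq_zero.1 h0
      omega
    rcases Int.eq_one_or_neg_one_of_mul_eq_one' h1 with ⟨-, rfl⟩ | ⟨-, rfl⟩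
    · left
      rw [hn', one_smul]
    · right
      rw [hn', neg_one_smul]
  · exact absurd h0 hq

/-- **The isometry induced via markings, with signs.** As `k3Form_markingConj`, but with the
generators of `H⁴` used by the markings (`p₀`, `p₀'`) and by the isometry hypothesis (`p`, `p'`)
allowed to differ by signs `s`, `s'`: then `σ = η ∘ φ ∘ η'⁻¹` multiplies the K3 form by `s' s`.
[cite: Buskin2019, §6.2, proof of Thm. 1.1] -/
theorem k3Form_markingConj_signed {S S' : Motives.SchemeOver ℂ}
    (η : HodgeTheory.complexBetti S (2 * 1) ≃ₗ[ℂ] (K3Index → ℂ))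
    (p₀ p : HodgeTheory.complexBetti S (2 * 2)) (hp₀ : p₀ ≠ 0) (s : ℂ) (hs : p = s • p₀)
    (hηcup : ∀ a b : HodgeTheory.complexBetti S (2 * 1),
      cupProduct (rfl : 2 * 1 + 2 * 1 = 2 * 2) a b = k3Form (η a) (η b) • p₀)
    (η' : HodgeTheory.complexBetti S' (2 * 1) ≃ₗ[ℂ] (K3Index → ℂ))
    (p₀' p' : HodgeTheory.complexBetti S' (2 * 2)) (s' : ℂ) (hs' : p₀' = s' • p')
    (hη'cup : ∀ a b : HodgeTheory.complexBetti S' (2 * 1),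
      cupProduct (rfl : 2 * 1 + 2 * 1 = 2 * 2) a b = k3Form (η' a) (η' b) • p₀')
    (φ : HodgeTheory.complexBetti S' (2 * 1) →ₗ[ℂ] HodgeTheory.complexBetti S (2 * 1))
    (hφ : ∀ (x y : HodgeTheory.complexBetti S' (2 * 1)) (a : ℂ),
      cupProduct (rfl : 2 * 1 + 2 * 1 = 2 * 2) x y = a • p' →
        cupProduct (rfl : 2 * 1 + 2 * 1 = 2 * 2) (φ x) (φ y) = a • p)
    (a b : K3Index → ℂ) :
    k3Form ((η.toLinearMap ∘ₗ φ ∘ₗ η'.symm.toLinearMap) a)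
      ((η.toLinearMap ∘ₗ φ ∘ₗ η'.symm.toLinearMap) b) = s' * s * k3Form a b := by
  have h1 : cupProduct (rfl : 2 * 1 + 2 * 1 = 2 * 2) (η'.symm a) (η'.symm b) =
      (k3Form a b * s') • p' := by
    rw [hη'cup, η'.apply_symm_apply, η'.apply_symm_apply, hs', smul_smul]
  have h2 := hφ _ _ _ h1
  rw [hηcup, hs, smul_smul] at h2
  have h3 := sub_eq_zero.2 h2
  rw [← sub_smul, smul_eq_zero, sub_eq_zero] at h3
  rcases h3 with h3 | h3
  · simp only [LinearMap.coe_comp, LinearEquiv.coe_coe, Function.comp_apply]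
    rw [h3]
    ring
  · exact absurd h3 hp₀

/-- `s_v ∘ s_v = 1` on `Λ_ℂ`. [folklore] -/
theorem k3ReflectionC_mul_self (v : K3Index → ℤ) : k3ReflectionC v * k3ReflectionC v = 1 :=
  reflection_mul_self k3FormC _

/-! ### Assembly of Buskin's proof of Thm. 1.1 (§6.2, p. 22) modulo its three remaining
ingredients: marked periods of K3 surfaces, Prop. 6.2 (reflective Hodge isometries are algebraic),
Lemma 6.3 (composition of algebraic correspondences) -/

section Assembly

/-- `MarkedK3[S, η, p, x]`: the data of a MARKED K3 SURFACE WITH PERIOD `x`, in the exact shape of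
the conclusion of `Huybrechts_K3_periodSurjective_projective` — `η : H²(S(ℂ); ℂ) ≅ Λ_ℂ`
identifies the integral classes with `Λ = ℤ²²` and the cup product with the lattice form times the
integral generator `p` of `H⁴(S(ℂ); ℤ)`, and `η⁻¹(x)` is of type `(2,0)` and spans `H^{2,0}(S)`
(Huybrechts Ch. 6 §3.2–3.3: marked K3 surfaces `(X, φ)`, `φ : H²(X, ℤ) ≅ Λ`, with period
`φ(H^{2,0}(X)) ∈ D ⊂ ℙ(Λ_ℂ)`). Local notation only, for the statements of this section. -/
local notation3 (prettyPrint := false) "MarkedK3[" S ", " η ", " p ", " x "]" =>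
  (HodgeTheory.IsIntegralClass p ∧
    (∀ q : HodgeTheory.complexBetti S (2 * 2), HodgeTheory.IsIntegralClass q → ∃ n : ℤ, q = n • p) ∧
    (∀ c : HodgeTheory.complexBetti S (2 * 1),
        HodgeTheory.IsIntegralClass c ↔ ∃ v : K3Index → ℤ, η c = fun i => (v i : ℂ)) ∧
    (∀ a b : HodgeTheory.complexBetti S (2 * 1),
        cupProduct (rfl : 2 * 1 + 2 * 1 = 2 * 2) a b = k3Form (η a) (η b) • p) ∧
    HodgeTheory.IsOfHodgeType 2 S (2 * 1) 2 0 (LinearEquiv.symm η x) ∧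
    (∀ τ : HodgeTheory.complexBetti S (2 * 1),
        HodgeTheory.IsOfHodgeType 2 S (2 * 1) 2 0 τ → ∃ t : ℂ, τ = t • LinearEquiv.symm η x))

/-- `PeriodPt[x]`: `x ∈ Λ_ℂ` is the period of a marked PROJECTIVE K3 surface in the sense of the
hypotheses of `Huybrechts_K3_periodSurjective_projective`: `(x.x) = 0`, `(x̄.x) > 0`
(Huybrechts Ch. 6 §1.1, the period domain `D`, and Prop. 2.3: `∫ σ ∧ σ = 0`, `∫ σ ∧ σ̄ > 0`)
and some lattice vector `u ∈ x^⊥` has `(u.u) > 0` (an ample class, Ch. 1 §3). Local notation only. -/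
local notation3 (prettyPrint := false) "PeriodPt[" x "]" =>
  (k3Form x x = 0 ∧ 0 < (k3Form (star x) x).re ∧
    ∃ u : K3Index → ℤ, k3Form (fun i => (u i : ℂ)) x = 0 ∧ 0 < ∑ i, ∑ j, u i * k3Gram i j * u j)

/-- `Corr[μ, S, S', hS, hS' ; γ, y] = [γ]_* y = fst_* (snd^* y ∪ γ) ∈ H²(S(ℂ); ℂ)`: the action on
`y ∈ H²(S'(ℂ); ℂ)` of a class `γ ∈ H⁴((S × S')(ℂ); ℂ)` as a correspondence from `S'` to `S`,
LITERALLY the expression in the conclusion of `Buskin2019_hodgeIsometry_algebraic` (Gysin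
morphism `complexGysin μ` of `fst : S × S' → S` relative to the orientation family `μ`).
Local notation only. -/
local notation3 (prettyPrint := false) "Corr[" μ ", " S ", " S' ", " hS ", " hS' " ; " γ ", " y "]" =>
  HodgeTheory.complexGysin μ
    (Motives.IsSmoothProjective.tensor_holds (IsK3Surface.isSmoothProjective hS)
      (IsK3Surface.isSmoothProjective hS'))
    (IsK3Surface.isSmoothProjective hS) (SemiCartesianMonoidalCategory.fst S S')
    (rfl : 2 * 1 + 2 * 2 + 2 * 2 = 2 * 1 + 2 * (2 + 2))
    (cupProduct (rfl : 2 * 1 + 2 * 2 = 2 * 1 + 2 * 2)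
      (HodgeTheory.complexBetti.map (SemiCartesianMonoidalCategory.snd S S') (2 * 1) y) γ)

/-- **The chain step of Buskin's proof of Thm. 1.1, iterated (§6.2, p. 22: "each `ψ_i` is
algebraic by Proposition (Cyclic-characteristic) and is thus given by an algebraic class
`α_i ∈ H^{2,2}(S_i × S_{i+1}, ℚ)`. Then taking the composition of the `α_i`'s as correspondences
by Lemma (lemma-composition) we obtain an algebraic class `α` … which induces the isometry `φ`").**
Granted (i) the projective surjectivity of the period map (the tree's named fact, hypothesis `h`),
(ii) `hrefl` — Buskin's Prop. 6.2 for REFLECTIVE isometries, in the tree's vocabulary: for marked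
projective K3 surfaces `(S, η, p, x)`, `(S', η', p', x')` and a non-isotropic lattice vector `v`
whose reflection carries the period line of `S'` to that of `S` (`s_v(x') ∈ ℂ x`), the rational
isometry `ψ = η⁻¹ ∘ s_v ∘ η' : H²(S'(ℂ)) → H²(S(ℂ))` (of cyclic type, §3 Example 3.2; a Hodge
isometry, as it is a rational isometry of K3 surfaces carrying `H^{2,0}` onto `H^{2,0}`:
Huybrechts Ch. 6 Prop. 1.2 and Example 1.3 (i), the Hodge structure of K3 type is determined by
its `(2,0)`-line) is `[γ]_*` for an algebraic class `γ` on `S × S'` — and (iii) `hcomp` —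
Lemma 6.3 with the composition rule for correspondences: `[γ]_* ∘ [γ']_* = [γ'']_*` for an
algebraic `γ''` on `S × S''` whenever `γ`, `γ'` are algebraic on `S × S'`, `S' × S''` — one gets:
for every NON-EMPTY list of non-isotropic lattice vectors `v_1, …, v_m`, every marked projective K3
surface `(S', η', p', x')` and every marked projective `(S, η, p, x)` whose period line contains
`s_{v_1} ∘ ⋯ ∘ s_{v_m}(x')`, the map `η⁻¹ ∘ s_{v_1} ∘ ⋯ ∘ s_{v_m} ∘ η' : H²(S'(ℂ)) → H²(S(ℂ))` is
`[γ]_*` for an algebraic class `γ` on `S × S'`. Induction on the list: the intermediate marked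
surface at the period `s_{v_2} ∘ ⋯ ∘ s_{v_m}(x')` exists and is projective by `h` and
`k3PeriodHypotheses_prod_k3ReflectionC`. [cite: Buskin2019, §6.2, proof of Thm. 1.1, Prop. 6.2 and Lemma 6.3]
[cite: Huybrechts2019, §1.1] [cite: Huybrechts2016K3, Ch. 6 Prop. 1.2, Example 1.3 (i) and Rem. 3.3] -/
theorem corr_prod_k3ReflectionC_of_reflective (μ : HodgeTheory.OrientationFamily)
    (h : Huybrechts_K3_periodSurjective_projective)
    (hrefl : ∀ (S S' : Motives.SchemeOver ℂ) (hS : IsK3Surface S) (hS' : IsK3Surface S')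
      (η : HodgeTheory.complexBetti S (2 * 1) ≃ₗ[ℂ] (K3Index → ℂ))
      (p : HodgeTheory.complexBetti S (2 * 2)) (x : K3Index → ℂ)
      (η' : HodgeTheory.complexBetti S' (2 * 1) ≃ₗ[ℂ] (K3Index → ℂ))
      (p' : HodgeTheory.complexBetti S' (2 * 2)) (x' : K3Index → ℂ),
      MarkedK3[S, η, p, x] → PeriodPt[x] → MarkedK3[S', η', p', x'] → PeriodPt[x'] →
      ∀ v : K3Index → ℤ, ∑ i, ∑ j, v i * k3Gram i j * v j ≠ 0 →
      (∃ t : ℂ, k3ReflectionC v x' = t • x) →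
      ∃ γ ∈ HodgeTheory.algebraicClasses (MonoidalCategoryStruct.tensorObj S S') 2,
        ∀ y : HodgeTheory.complexBetti S' (2 * 1),
          η.symm (k3ReflectionC v (η' y)) = Corr[μ, S, S', hS, hS' ; γ, y])
    (hcomp : ∀ (S S' S'' : Motives.SchemeOver ℂ) (hS : IsK3Surface S) (hS' : IsK3Surface S')
      (hS'' : IsK3Surface S''),
      ∀ γ ∈ HodgeTheory.algebraicClasses (MonoidalCategoryStruct.tensorObj S S') 2,
      ∀ γ' ∈ HodgeTheory.algebraicClasses (MonoidalCategoryStruct.tensorObj S' S'') 2,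
      ∃ γ'' ∈ HodgeTheory.algebraicClasses (MonoidalCategoryStruct.tensorObj S S'') 2,
        ∀ y : HodgeTheory.complexBetti S'' (2 * 1),
          Corr[μ, S, S'', hS, hS'' ; γ'', y] = Corr[μ, S, S', hS, hS' ; γ, Corr[μ, S', S'', hS', hS'' ; γ', y]])
    (l : List (K3Index → ℤ)) (hl0 : l ≠ []) (hl : ∀ v ∈ l, ∑ i, ∑ j, v i * k3Gram i j * v j ≠ 0)
    {S' : Motives.SchemeOver ℂ} (hS' : IsK3Surface S')
    (η' : HodgeTheory.complexBetti S' (2 * 1) ≃ₗ[ℂ] (K3Index → ℂ))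
    (p' : HodgeTheory.complexBetti S' (2 * 2)) (x' : K3Index → ℂ)
    (hm' : MarkedK3[S', η', p', x']) (hx' : PeriodPt[x']) :
    ∀ {S : Motives.SchemeOver ℂ} (hS : IsK3Surface S)
      (η : HodgeTheory.complexBetti S (2 * 1) ≃ₗ[ℂ] (K3Index → ℂ))
      (p : HodgeTheory.complexBetti S (2 * 2)) (x : K3Index → ℂ),
      MarkedK3[S, η, p, x] → PeriodPt[x] → (∃ t : ℂ, (l.map k3ReflectionC).prod x' = t • x) →
      ∃ γ ∈ HodgeTheory.algebraicClasses (MonoidalCategoryStruct.tensorObj S S') 2,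
        ∀ y : HodgeTheory.complexBetti S' (2 * 1),
          η.symm ((l.map k3ReflectionC).prod (η' y)) = Corr[μ, S, S', hS, hS' ; γ, y] := by
  induction l with
  | nil => exact absurd rfl hl0
  | cons v l ih =>
    intro S hS η p x hm hx hper
    have hv : ∑ i, ∑ j, v i * k3Gram i j * v j ≠ 0 := hl v List.mem_cons_self
    by_cases hl' : l = []
    · -- a single reflection: Prop. 6.2 directly between `(S', η')` and `(S, η)`
      subst hl'
      simp only [List.map_cons, List.map_nil, List.prod_cons, List.prod_nil, mul_one] at hper ⊢
      exact hrefl S S' hS hS' η p x η' p' x' hm hx hm' hx' v hv hper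
    · -- the intermediate marked projective K3 surface at the period `l' = s_{v_2} ∘ ⋯ (x')`
      obtain ⟨h1, h2, h3⟩ := k3PeriodHypotheses_prod_k3ReflectionC l hx'.1 hx'.2.1 hx'.2.2
      obtain ⟨S₁, hS₁, η₁, p₁, hm₁⟩ := h _ h1 h2 h3
      -- induction hypothesis: from `S'` to `S₁`
      obtain ⟨γ', hγ', hγ'eq⟩ := ih hl' (fun w hw => hl w (List.mem_cons_of_mem v hw)) hS₁ η₁ p₁
        ((l.map k3ReflectionC).prod x') hm₁ ⟨h1, h2, h3⟩ ⟨1, (one_smul _ _).symm⟩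
      -- one reflective step: from `S₁` to `S`
      have hper₁ : ∃ t : ℂ, k3ReflectionC v ((l.map k3ReflectionC).prod x') = t • x := by
        simpa only [List.map_cons, List.prod_cons, Module.End.mul_apply] using hper
      obtain ⟨γ₁, hγ₁, hγ₁eq⟩ :=
        hrefl S S₁ hS hS₁ η p x η₁ p₁ _ hm hx hm₁ ⟨h1, h2, h3⟩ v hv hper₁
      -- compose the two correspondences
      obtain ⟨γ, hγ, hγeq⟩ := hcomp S S₁ S' hS hS₁ hS' γ₁ hγ₁ γ' hγ'
      refine ⟨γ, hγ, fun y => ?_⟩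
      rw [hγeq, ← hγ'eq, ← hγ₁eq, LinearEquiv.apply_symm_apply, List.map_cons, List.prod_cons,
        Module.End.mul_apply]

/-- **Buskin's Theorem 1.1 from its three remaining ingredients** (the whole of §6.2, proof of
Thm. 1.1, p. 22, in the tree's vocabulary). Granted
* `h` — the surjectivity of the period map, projective form (the tree's named fact
  `Huybrechts_K3_periodSurjective_projective`; "using the surjectivity of the period map for marked
  K3 surfaces we obtain a sequence of marked K3 surfaces `(S, η), (S_1, η_1), …, (S', η')`");
* `hmark` — every K3 surface `S` admits a marking with a projective period: an isometry
  `η : H²(S(ℂ); ℂ) ≅ Λ_ℂ` carrying the integral classes onto `Λ_{K3} = E₈(−1)^{⊕2} ⊕ U^{⊕3}`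
  and the cup product to the lattice form times a NON-ZERO integral generator `p` of `H⁴`
  (Huybrechts Ch. 1 Prop. 3.5: "`H²(X, ℤ) ≃ E₈(−1) ⊕ E₈(−1) ⊕ U ⊕ U ⊕ U`"; `H⁴(X, ℤ) ≅ ℤ`), a
  generator `η⁻¹(x)` of the line `H^{2,0}(S)` (Ch. 3 Def. 2.3: `dim H^{2,0} = 1`) with `(x.x) = 0`,
  `(x̄.x) > 0` (Ch. 6 §1.1 and Prop. 2.3: the period lies in `D`), and a lattice vector `u ∈ x^⊥` with
  `(u.u) > 0`
  (an ample class; `S` is projective) — Buskin's "inducing via markings `η, η'`";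
* `hrefl` — Prop. 6.2 (Cyclic-characteristic) for reflective isometries: for marked projective K3
  surfaces `(S, η, p, x)`, `(S', η', p', x')` and a non-isotropic `v ∈ Λ` with `s_v(x') ∈ ℂ x`, the
  rational Hodge isometry of cyclic type `η⁻¹ ∘ s_v ∘ η'` is `[γ]_*` for an algebraic class `γ` on
  `S × S'` (read through the Künneth/Poincaré-duality dictionary `Z_ψ ↔ [γ]_*` of the statement);
* `hcomp` — Lemma 6.3 (lemma-composition) with the composition rule for correspondences:
  `[γ]_* ∘ [γ']_* = [γ'']_*` for an algebraic `γ''` when `γ`, `γ'` are algebraic;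
the named fact `Buskin2019_hodgeIsometry_algebraic` follows, exactly as printed: the generators
`p, p'` of the statement agree with those of the markings up to signs (`eq_or_eq_neg_of_zsmul`),
opposite signs being impossible (`σ = η ∘ φ ∘ η'⁻¹` would be an anti-isometry of `Λ_ℚ`,
`not_antiIsometry_k3Form`); so `σ` is a rational isometry, a product of reflections along
non-isotropic lattice vectors (Cartan–Dieudonné, `exists_eq_prod_k3ReflectionC`; an empty
product is rewritten `s_u ∘ s_u`), `σ` carries the period of `(S', η')` to that of `(S, η)` because
`φ` preserves the type `(2,0)`, and `corr_prod_k3ReflectionC_of_reflective` composes the chain.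
[cite: Buskin2019, Thm. 1.1 and §6.2 (proof of Thm. 1.1, Prop. 6.2, Lemma 6.3)]
[cite: Huybrechts2019, §1.1] [cite: Huybrechts2016K3, Ch. 1 Prop. 3.5, Ch. 3 Def. 2.3, Ch. 6 §1.1, Prop. 1.2, Prop. 2.3 and Rem. 3.3] -/
theorem Buskin2019_hodgeIsometry_algebraic_of_reflective
    (h : Huybrechts_K3_periodSurjective_projective)
    (hmark : ∀ (S : Motives.SchemeOver ℂ), IsK3Surface S →
      ∃ (η : HodgeTheory.complexBetti S (2 * 1) ≃ₗ[ℂ] (K3Index → ℂ))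
        (p : HodgeTheory.complexBetti S (2 * 2)) (x : K3Index → ℂ),
        p ≠ 0 ∧ MarkedK3[S, η, p, x] ∧ PeriodPt[x])
    (hrefl : ∀ (μ : HodgeTheory.OrientationFamily), μ.HasPoincareDuality →
      ∀ (S S' : Motives.SchemeOver ℂ) (hS : IsK3Surface S) (hS' : IsK3Surface S')
      (η : HodgeTheory.complexBetti S (2 * 1) ≃ₗ[ℂ] (K3Index → ℂ))
      (p : HodgeTheory.complexBetti S (2 * 2)) (x : K3Index → ℂ)
      (η' : HodgeTheory.complexBetti S' (2 * 1) ≃ₗ[ℂ] (K3Index → ℂ))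
      (p' : HodgeTheory.complexBetti S' (2 * 2)) (x' : K3Index → ℂ),
      MarkedK3[S, η, p, x] → PeriodPt[x] → MarkedK3[S', η', p', x'] → PeriodPt[x'] →
      ∀ v : K3Index → ℤ, ∑ i, ∑ j, v i * k3Gram i j * v j ≠ 0 →
      (∃ t : ℂ, k3ReflectionC v x' = t • x) →
      ∃ γ ∈ HodgeTheory.algebraicClasses (MonoidalCategoryStruct.tensorObj S S') 2,
        ∀ y : HodgeTheory.complexBetti S' (2 * 1),
          η.symm (k3ReflectionC v (η' y)) = Corr[μ, S, S', hS, hS' ; γ, y])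
    (hcomp : ∀ (μ : HodgeTheory.OrientationFamily), μ.HasPoincareDuality →
      ∀ (S S' S'' : Motives.SchemeOver ℂ) (hS : IsK3Surface S) (hS' : IsK3Surface S')
      (hS'' : IsK3Surface S''),
      ∀ γ ∈ HodgeTheory.algebraicClasses (MonoidalCategoryStruct.tensorObj S S') 2,
      ∀ γ' ∈ HodgeTheory.algebraicClasses (MonoidalCategoryStruct.tensorObj S' S'') 2,
      ∃ γ'' ∈ HodgeTheory.algebraicClasses (MonoidalCategoryStruct.tensorObj S S'') 2,
        ∀ y : HodgeTheory.complexBetti S'' (2 * 1),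
          Corr[μ, S, S'', hS, hS'' ; γ'', y] = Corr[μ, S, S', hS, hS' ; γ, Corr[μ, S', S'', hS', hS'' ; γ', y]]) :
    Buskin2019_hodgeIsometry_algebraic := by
  intro μ hμ S S' hS hS' p p' hp hp' φ hrat htype hiso
  obtain ⟨η, p₀, x, hp₀, hm, hx⟩ := hmark S hS
  obtain ⟨η', p₀', x', hp₀', hm', hx'⟩ := hmark S' hS'
  -- the generators of `H⁴` of the statement are those of the markings up to sign
  have hsg : p = p₀ ∨ p = -p₀ := eq_or_eq_neg_of_zsmul hp₀ (hp.2 p₀ hm.1) (hm.2.1 p hp.1)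
  have hsg' : p' = p₀' ∨ p' = -p₀' := eq_or_eq_neg_of_zsmul hp₀' (hp'.2 p₀' hm'.1) (hm'.2.1 p' hp'.1)
  obtain ⟨s, hs, hs1⟩ : ∃ s : ℂ, p = s • p₀ ∧ (s = 1 ∨ s = -1) := by
    rcases hsg with hsg | hsg
    · exact ⟨1, by rw [hsg, one_smul], Or.inl rfl⟩
    · exact ⟨-1, by rw [hsg, neg_one_smul], Or.inr rfl⟩
  obtain ⟨s', hs', hs1'⟩ : ∃ s' : ℂ, p₀' = s' • p' ∧ (s' = 1 ∨ s' = -1) := by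
    rcases hsg' with hsg' | hsg'
    · exact ⟨1, by rw [hsg', one_smul], Or.inl rfl⟩
    · exact ⟨-1, by rw [hsg', smul_neg, neg_one_smul, neg_neg], Or.inr rfl⟩
  -- the isometry `σ = η ∘ φ ∘ η'⁻¹` of `Λ_ℚ`
  set σ : Module.End ℂ (K3Index → ℂ) := η.toLinearMap ∘ₗ φ ∘ₗ η'.symm.toLinearMap with hσdef
  have hσrat : ∀ v : K3Index → ℤ, ∃ w : K3Index → ℚ, σ (fun i => (v i : ℂ)) = fun i => (w i : ℂ) :=
    markingConj_intCast hS η hm.2.2.1 η' hm'.2.2.1 φ hrat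
  have hσform : ∀ a b, k3Form (σ a) (σ b) = s' * s * k3Form a b :=
    k3Form_markingConj_signed η p₀ p hp₀ s hs hm.2.2.2.1 η' p₀' p' s' hs' hm'.2.2.2.1 φ hiso
  -- opposite signs would make `σ` an anti-isometry of `Λ_ℚ`, which does not exist
  have hss : s' * s = 1 := by
    rcases hs1 with rfl | rfl <;> rcases hs1' with rfl | rfl
    · norm_num
    · exact (not_antiIsometry_k3Form σ (fun a b => by rw [hσform]; ring) hσrat).elim
    · exact (not_antiIsometry_k3Form σ (fun a b => by rw [hσform]; ring) hσrat).elim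
    · norm_num
  have hσiso : ∀ a b, k3Form (σ a) (σ b) = k3Form a b := fun a b => by
    rw [hσform, hss, one_mul]
  -- Cartan–Dieudonné: `σ` is a product of reflections along non-isotropic lattice vectors
  obtain ⟨l, hl, -, hσl⟩ := exists_eq_prod_k3ReflectionC σ hσiso hσrat
  -- make the list non-empty (`1 = s_u ∘ s_u` for the positive lattice vector `u ∈ x'^⊥`)
  obtain ⟨u, -, hu⟩ := hx'.2.2
  obtain ⟨lne, hlne0, hlne, hσlne⟩ : ∃ lne : List (K3Index → ℤ), lne ≠ [] ∧
      (∀ v ∈ lne, ∑ i, ∑ j, v i * k3Gram i j * v j ≠ 0) ∧ σ = (lne.map k3ReflectionC).prod := by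
    cases l with
    | nil =>
      refine ⟨[u, u], List.cons_ne_nil _ _, fun v hv => ?_, ?_⟩
      · simp only [List.mem_cons, List.not_mem_nil, or_false, or_self] at hv
        rw [hv]
        exact hu.ne'
      · rw [hσl]
        simp [k3ReflectionC_mul_self]
    | cons v l => exact ⟨v :: l, List.cons_ne_nil _ _, hl, hσl⟩
  -- `σ` carries the period of `(S', η')` into the period line of `(S, η)`: `φ` preserves `(2,0)`
  have hper : ∃ t : ℂ, (lne.map k3ReflectionC).prod x' = t • x := by
    have h20 : HodgeTheory.IsOfHodgeType 2 S (2 * 1) 2 0 (φ (η'.symm x')) := htype 2 0 _ hm'.2.2.2.2.1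
    obtain ⟨t, ht⟩ := hm.2.2.2.2.2 _ h20
    refine ⟨t, ?_⟩
    rw [← hσlne, hσdef]
    simp only [LinearMap.coe_comp, LinearEquiv.coe_coe, Function.comp_apply]
    rw [ht, map_smul, LinearEquiv.apply_symm_apply]
  -- the chain of marked K3 surfaces and the composition of the reflective correspondences
  obtain ⟨γ, hγ, hγeq⟩ := corr_prod_k3ReflectionC_of_reflective μ h (hrefl μ hμ) (hcomp μ hμ) lne hlne0
    hlne hS' η' p₀' x' hm' hx' hS η p₀ x hm hx hper
  refine ⟨γ, hγ, fun y => ?_⟩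
  rw [← hγeq, ← hσlne, hσdef]
  simp only [LinearMap.coe_comp, LinearEquiv.coe_coe, Function.comp_apply,
    LinearEquiv.symm_apply_apply]

end Assembly

/-! ### The markings ingredient from the tree's fact `Huybrechts_K3_markedPeriod_projective` -/

section MarkedPeriod

/-- `MarkedK3[S, η, p, x]` (as in the section `Assembly`): `η : H²(S(ℂ); ℂ) ≅ Λ_ℂ` identifies
the integral classes with `Λ = ℤ²²` and the cup product with the lattice form times the integral
generator `p` of `H⁴(S(ℂ); ℤ)`, and `η⁻¹(x)` is of type `(2,0)` and spans `H^{2,0}(S)`.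
Local notation only. -/
local notation3 (prettyPrint := false) "MarkedK3[" S ", " η ", " p ", " x "]" =>
  (HodgeTheory.IsIntegralClass p ∧
    (∀ q : HodgeTheory.complexBetti S (2 * 2), HodgeTheory.IsIntegralClass q → ∃ n : ℤ, q = n • p) ∧
    (∀ c : HodgeTheory.complexBetti S (2 * 1),
        HodgeTheory.IsIntegralClass c ↔ ∃ v : K3Index → ℤ, η c = fun i => (v i : ℂ)) ∧
    (∀ a b : HodgeTheory.complexBetti S (2 * 1),
        cupProduct (rfl : 2 * 1 + 2 * 1 = 2 * 2) a b = k3Form (η a) (η b) • p) ∧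
    HodgeTheory.IsOfHodgeType 2 S (2 * 1) 2 0 (LinearEquiv.symm η x) ∧
    (∀ τ : HodgeTheory.complexBetti S (2 * 1),
        HodgeTheory.IsOfHodgeType 2 S (2 * 1) 2 0 τ → ∃ t : ℂ, τ = t • LinearEquiv.symm η x))

/-- `PeriodPt[x]` (as in the section `Assembly`): `(x.x) = 0`, `(x̄.x) > 0` and some lattice
vector `u ∈ x^⊥` has `(u.u) > 0`. Local notation only. -/
local notation3 (prettyPrint := false) "PeriodPt[" x "]" =>
  (k3Form x x = 0 ∧ 0 < (k3Form (star x) x).re ∧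
    ∃ u : K3Index → ℤ, k3Form (fun i => (u i : ℂ)) x = 0 ∧ 0 < ∑ i, ∑ j, u i * k3Gram i j * u j)

/-- `Corr[μ, S, S', hS, hS' ; γ, y] = [γ]_* y = fst_* (snd^* y ∪ γ)` (as in the section
`Assembly`): LITERALLY the expression in the conclusion of `Buskin2019_hodgeIsometry_algebraic`.
Local notation only. -/
local notation3 (prettyPrint := false) "Corr[" μ ", " S ", " S' ", " hS ", " hS' " ; " γ ", " y "]" =>
  HodgeTheory.complexGysin μ
    (Motives.IsSmoothProjective.tensor_holds (IsK3Surface.isSmoothProjective hS)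
      (IsK3Surface.isSmoothProjective hS'))
    (IsK3Surface.isSmoothProjective hS) (SemiCartesianMonoidalCategory.fst S S')
    (rfl : 2 * 1 + 2 * 2 + 2 * 2 = 2 * 1 + 2 * (2 + 2))
    (cupProduct (rfl : 2 * 1 + 2 * 2 = 2 * 1 + 2 * 2)
      (HodgeTheory.complexBetti.map (SemiCartesianMonoidalCategory.snd S S') (2 * 1) y) γ)

/-- **The integral generator of `H⁴` of a marking is non-zero.** For a smooth projective surface
`S` whose cup product `H² × H² → H⁴` on `S(ℂ)` reads `a ∪ b = (η a.η b) • p` through a linear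
equivalence `η : H²(S(ℂ); ℂ) ≃ Λ_ℂ` (the cup-product clause of a marking, as in
`Huybrechts_K3_periodSurjective_projective` and `Huybrechts_K3_markedPeriod_projective`), the class
`p` is non-zero: otherwise every cup product `H² × H² → H⁴` vanishes, so every class of
`H²(S(ℂ); ℂ)` pairs to zero with everything under the Poincaré pairing `⟨a ∪ b, [S(ℂ)]⟩` of the
closed oriented `4`-manifold `S(ℂ)` (any orientation family `μ`), which is perfect over the field
`ℂ` (Hatcher Prop. 3.38; the tree's theorem `isPerfPair_cupPairing_of_field_holds`), whence
`H²(S(ℂ); ℂ) = 0` — contradicting `H²(S(ℂ); ℂ) ≅ Λ_ℂ = ℂ²² ≠ 0`. (Huybrechts Ch. 1 §3.3 reads the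
intersection form through the fundamental class, for which this is automatic; the tree's marking
facts carry an abstract integral generator `p`, so the clause is recorded.) [cite: HatcherAT2002, §3.3 Prop. 3.38]
[cite: Huybrechts2016K3, Ch. 1 §3.3 and Prop. 3.5] -/
theorem ne_zero_of_cupProduct_eq_k3Form_smul (μ : HodgeTheory.OrientationFamily)
    {S : Motives.SchemeOver ℂ} (hS : Motives.IsSmoothProjective 2 S)
    (η : HodgeTheory.complexBetti S (2 * 1) ≃ₗ[ℂ] (K3Index → ℂ))
    (p : HodgeTheory.complexBetti S (2 * 2))
    (hcup : ∀ a b : HodgeTheory.complexBetti S (2 * 1),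
      cupProduct (rfl : 2 * 1 + 2 * 1 = 2 * 2) a b = k3Form (η a) (η b) • p) :
    p ≠ 0 := by
  intro hp
  letI := hS.chartedSpace
  haveI := Motives.ComplexPoints.compactSpace_of_isSmoothProjective hS
  haveI := Motives.ComplexPoints.t2Space_of_isSmoothProjective hS
  -- Hatcher Prop. 3.38 over the field `ℂ` for the closed oriented `4`-manifold `S(ℂ)`
  have hP : (cupPairing (μ hS) (rfl : 2 * 1 + 2 * 1 = 2 * 2)).IsPerfPair :=
    isPerfPair_cupPairing_of_field_holds
  have hzero : ∀ a : HodgeTheory.complexBetti S (2 * 1), a = 0 := fun a => by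
    refine hP.bijective_left.1 ?_
    rw [map_zero]
    exact LinearMap.ext fun b => by
      rw [cupPairing_apply, hcup, hp, smul_zero, map_zero, LinearMap.zero_apply, LinearMap.zero_apply]
  have h1 : (fun _ : K3Index => (1 : ℂ)) = 0 := by
    have h0 := congrArg η (hzero (η.symm fun _ => 1))
    rwa [LinearEquiv.apply_symm_apply, map_zero] at h0
  exact one_ne_zero (congrFun h1 (Sum.inr (Sum.inl 0)))

/-- **Buskin's Theorem 1.1 from the tree's two period facts and its two remaining printed
ingredients.** The assembly `Buskin2019_hodgeIsometry_algebraic_of_reflective` with its markings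
hypothesis `hmark` SUPPLIED by the tree's named fact `Huybrechts_K3_marking_exists`
(`K3Marking.lean`; Huybrechts Ch. 1 Prop. 3.5: `H²(X, ℤ) ≃ E₈(−1)^{⊕2} ⊕ U^{⊕3}` with the cup form;
Ch. 3 Def. 2.3: `h^{2,0} = 1`; Ch. 6 §1.1 and Prop. 1.2: the period satisfies `(x.x) = 0`,
`(x̄.x) > 0`; Ch. 1 §3: an ample class gives a positive lattice vector in `x^⊥` — stated there in
exactly the shape of `hmark`). Granted, besides the two EXISTING named facts `h` (surjectivity of
the period map, projective form) and `hM` (markings with projective periods), exactly the two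
printed results still absent from the tree — `hrefl`, Buskin's Prop. 6.2 for the reflective
rational Hodge isometries `η⁻¹ ∘ s_v ∘ η'` between marked projective K3 surfaces, and `hcomp`, his
Lemma 6.3 with the composition rule `[γ]_* ∘ [γ']_* = [γ'']_*` for algebraic correspondences —
the named fact `Buskin2019_hodgeIsometry_algebraic` follows. [cite: Buskin2019, Thm. 1.1 and §6.2 (proof of Thm. 1.1, Prop. 6.2, Lemma 6.3)]
[cite: Huybrechts2019, §1.1] [cite: Huybrechts2016K3, Ch. 1 Prop. 3.5 and §3, Ch. 3 Def. 2.3, Ch. 6 §1.1, Prop. 1.2 and Rem. 3.3] -/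
theorem Buskin2019_hodgeIsometry_algebraic_of_marking
    (h : Huybrechts_K3_periodSurjective_projective) (hM : Huybrechts_K3_marking_exists)
    (hrefl : ∀ (μ : HodgeTheory.OrientationFamily), μ.HasPoincareDuality →
      ∀ (S S' : Motives.SchemeOver ℂ) (hS : IsK3Surface S) (hS' : IsK3Surface S')
      (η : HodgeTheory.complexBetti S (2 * 1) ≃ₗ[ℂ] (K3Index → ℂ))
      (p : HodgeTheory.complexBetti S (2 * 2)) (x : K3Index → ℂ)
      (η' : HodgeTheory.complexBetti S' (2 * 1) ≃ₗ[ℂ] (K3Index → ℂ))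
      (p' : HodgeTheory.complexBetti S' (2 * 2)) (x' : K3Index → ℂ),
      MarkedK3[S, η, p, x] → PeriodPt[x] → MarkedK3[S', η', p', x'] → PeriodPt[x'] →
      ∀ v : K3Index → ℤ, ∑ i, ∑ j, v i * k3Gram i j * v j ≠ 0 →
      (∃ t : ℂ, k3ReflectionC v x' = t • x) →
      ∃ γ ∈ HodgeTheory.algebraicClasses (MonoidalCategoryStruct.tensorObj S S') 2,
        ∀ y : HodgeTheory.complexBetti S' (2 * 1),
          η.symm (k3ReflectionC v (η' y)) = Corr[μ, S, S', hS, hS' ; γ, y])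
    (hcomp : ∀ (μ : HodgeTheory.OrientationFamily), μ.HasPoincareDuality →
      ∀ (S S' S'' : Motives.SchemeOver ℂ) (hS : IsK3Surface S) (hS' : IsK3Surface S')
      (hS'' : IsK3Surface S''),
      ∀ γ ∈ HodgeTheory.algebraicClasses (MonoidalCategoryStruct.tensorObj S S') 2,
      ∀ γ' ∈ HodgeTheory.algebraicClasses (MonoidalCategoryStruct.tensorObj S' S'') 2,
      ∃ γ'' ∈ HodgeTheory.algebraicClasses (MonoidalCategoryStruct.tensorObj S S'') 2,
        ∀ y : HodgeTheory.complexBetti S'' (2 * 1),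
          Corr[μ, S, S'', hS, hS'' ; γ'', y] = Corr[μ, S, S', hS, hS' ; γ, Corr[μ, S', S'', hS', hS'' ; γ', y]]) :
    Buskin2019_hodgeIsometry_algebraic :=
  Buskin2019_hodgeIsometry_algebraic_of_reflective h hM hrefl hcomp

/-- The same assembly from marking data WITHOUT the clause `p ≠ 0` (the shape of the conclusion of
`Huybrechts_K3_periodSurjective_projective` conjoined with its hypotheses, for every K3 surface):
that clause is supplied by `ne_zero_of_cupProduct_eq_k3Form_smul`, run with the orientation
family of the statement. [cite: Buskin2019, Thm. 1.1 and §6.2] [cite: HatcherAT2002, §3.3 Prop. 3.38] -/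
theorem Buskin2019_hodgeIsometry_algebraic_of_marking'
    (h : Huybrechts_K3_periodSurjective_projective)
    (hM : ∀ (S : Motives.SchemeOver ℂ), IsK3Surface S →
      ∃ (η : HodgeTheory.complexBetti S (2 * 1) ≃ₗ[ℂ] (K3Index → ℂ))
        (p : HodgeTheory.complexBetti S (2 * 2)) (x : K3Index → ℂ),
        MarkedK3[S, η, p, x] ∧ PeriodPt[x])
    (hrefl : ∀ (μ : HodgeTheory.OrientationFamily), μ.HasPoincareDuality →
      ∀ (S S' : Motives.SchemeOver ℂ) (hS : IsK3Surface S) (hS' : IsK3Surface S')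
      (η : HodgeTheory.complexBetti S (2 * 1) ≃ₗ[ℂ] (K3Index → ℂ))
      (p : HodgeTheory.complexBetti S (2 * 2)) (x : K3Index → ℂ)
      (η' : HodgeTheory.complexBetti S' (2 * 1) ≃ₗ[ℂ] (K3Index → ℂ))
      (p' : HodgeTheory.complexBetti S' (2 * 2)) (x' : K3Index → ℂ),
      MarkedK3[S, η, p, x] → PeriodPt[x] → MarkedK3[S', η', p', x'] → PeriodPt[x'] →
      ∀ v : K3Index → ℤ, ∑ i, ∑ j, v i * k3Gram i j * v j ≠ 0 →
      (∃ t : ℂ, k3ReflectionC v x' = t • x) →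
      ∃ γ ∈ HodgeTheory.algebraicClasses (MonoidalCategoryStruct.tensorObj S S') 2,
        ∀ y : HodgeTheory.complexBetti S' (2 * 1),
          η.symm (k3ReflectionC v (η' y)) = Corr[μ, S, S', hS, hS' ; γ, y])
    (hcomp : ∀ (μ : HodgeTheory.OrientationFamily), μ.HasPoincareDuality →
      ∀ (S S' S'' : Motives.SchemeOver ℂ) (hS : IsK3Surface S) (hS' : IsK3Surface S')
      (hS'' : IsK3Surface S''),
      ∀ γ ∈ HodgeTheory.algebraicClasses (MonoidalCategoryStruct.tensorObj S S') 2,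
      ∀ γ' ∈ HodgeTheory.algebraicClasses (MonoidalCategoryStruct.tensorObj S' S'') 2,
      ∃ γ'' ∈ HodgeTheory.algebraicClasses (MonoidalCategoryStruct.tensorObj S S'') 2,
        ∀ y : HodgeTheory.complexBetti S'' (2 * 1),
          Corr[μ, S, S'', hS, hS'' ; γ'', y] = Corr[μ, S, S', hS, hS' ; γ, Corr[μ, S', S'', hS', hS'' ; γ', y]]) :
    Buskin2019_hodgeIsometry_algebraic := by
  intro μ hμ
  have hmark : ∀ (S : Motives.SchemeOver ℂ), IsK3Surface S →
      ∃ (η : HodgeTheory.complexBetti S (2 * 1) ≃ₗ[ℂ] (K3Index → ℂ))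
        (p : HodgeTheory.complexBetti S (2 * 2)) (x : K3Index → ℂ),
        p ≠ 0 ∧ MarkedK3[S, η, p, x] ∧ PeriodPt[x] := by
    intro S hS
    obtain ⟨η, p, x, hm, hx⟩ := hM S hS
    exact ⟨η, p, x, ne_zero_of_cupProduct_eq_k3Form_smul μ hS.isSmoothProjective η p hm.2.2.2.1,
      hm, hx⟩
  exact Buskin2019_hodgeIsometry_algebraic_of_reflective h hmark hrefl hcomp μ hμ

end MarkedPeriod

/-! ### One orientation family suffices for the two remaining ingredients

The statement `Buskin2019_hodgeIsometry_algebraic` and the hypotheses `hrefl`, `hcomp` of the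
assemblies above quantify over ALL orientation families `μ` with Poincaré duality, whereas a proof
of Buskin's Prop. 6.2 or Lemma 6.3 on the tree's carriers naturally produces its algebraic class at
ONE family `μ₀` (the complex orientations, say). Since `X(ℂ)` is connected for `X` smooth
projective, two families have proportional fundamental classes and
`complexGysin μ = c • complexGysin μ₀` with `c ≠ 0` (the tree's
`HodgeTheory.complexGysin_eq_smul_of_orientationFamily`, Fulton, *Young Tableaux*, App. B §B.1 (5);
Hatcher Thm. 3.26), so `[γ]_*^μ = c • [γ]_*^{μ₀}` with `c` depending only on `(S, S', μ, μ₀)`, and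
the `ℂ`-submodule `algebraicClasses (S ⊗ S') 2` absorbs the scalar (`γ ↦ c⁻¹ • γ`). Hence `hrefl`
and `hcomp` at `μ₀` give them at every `μ`, and Thm. 1.1 follows from its four inputs with the two
printed ones required at a single orientation family. -/

section OrientationTransport

/-- `MarkedK3[S, η, p, x]` (as in the section `Assembly`). Local notation only. -/
local notation3 (prettyPrint := false) "MarkedK3[" S ", " η ", " p ", " x "]" =>
  (HodgeTheory.IsIntegralClass p ∧
    (∀ q : HodgeTheory.complexBetti S (2 * 2), HodgeTheory.IsIntegralClass q → ∃ n : ℤ, q = n • p) ∧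
    (∀ c : HodgeTheory.complexBetti S (2 * 1),
        HodgeTheory.IsIntegralClass c ↔ ∃ v : K3Index → ℤ, η c = fun i => (v i : ℂ)) ∧
    (∀ a b : HodgeTheory.complexBetti S (2 * 1),
        cupProduct (rfl : 2 * 1 + 2 * 1 = 2 * 2) a b = k3Form (η a) (η b) • p) ∧
    HodgeTheory.IsOfHodgeType 2 S (2 * 1) 2 0 (LinearEquiv.symm η x) ∧
    (∀ τ : HodgeTheory.complexBetti S (2 * 1),
        HodgeTheory.IsOfHodgeType 2 S (2 * 1) 2 0 τ → ∃ t : ℂ, τ = t • LinearEquiv.symm η x))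

/-- `PeriodPt[x]` (as in the section `Assembly`). Local notation only. -/
local notation3 (prettyPrint := false) "PeriodPt[" x "]" =>
  (k3Form x x = 0 ∧ 0 < (k3Form (star x) x).re ∧
    ∃ u : K3Index → ℤ, k3Form (fun i => (u i : ℂ)) x = 0 ∧ 0 < ∑ i, ∑ j, u i * k3Gram i j * u j)

/-- `Corr[μ, S, S', hS, hS' ; γ, y] = [γ]_* y = fst_* (snd^* y ∪ γ)` (as in the section
`Assembly`). Local notation only. -/
local notation3 (prettyPrint := false) "Corr[" μ ", " S ", " S' ", " hS ", " hS' " ; " γ ", " y "]" =>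
  HodgeTheory.complexGysin μ
    (Motives.IsSmoothProjective.tensor_holds (IsK3Surface.isSmoothProjective hS)
      (IsK3Surface.isSmoothProjective hS'))
    (IsK3Surface.isSmoothProjective hS) (SemiCartesianMonoidalCategory.fst S S')
    (rfl : 2 * 1 + 2 * 2 + 2 * 2 = 2 * 1 + 2 * (2 + 2))
    (cupProduct (rfl : 2 * 1 + 2 * 2 = 2 * 1 + 2 * 2)
      (HodgeTheory.complexBetti.map (SemiCartesianMonoidalCategory.snd S S') (2 * 1) y) γ)

/-- **`[γ]_*` changes by a non-zero scalar with the orientation family**: for K3 surfaces `S, S'`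
and orientation families `μ₀, μ` with Poincaré duality there is `c ≠ 0` with
`[γ]_*^μ y = c • [γ]_*^{μ₀} y` for all `γ ∈ H⁴((S ⊗ S')(ℂ); ℂ)` and `y ∈ H²(S'(ℂ); ℂ)` — the
Gysin morphism `fst_*` is the only place the family enters, and
`complexGysin μ = c • complexGysin μ₀` (`HodgeTheory.complexGysin_eq_smul_of_orientationFamily`).
[cite: FultonYoungTableaux1997, Appendix B §B.1 (5)] [cite: HatcherAT2002, §3.3 Thm. 3.26] -/
theorem corr_eq_smul_of_orientationFamily {μ₀ μ : HodgeTheory.OrientationFamily}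
    (hμ₀ : μ₀.HasPoincareDuality) (hμ : μ.HasPoincareDuality)
    {S S' : Motives.SchemeOver ℂ} (hS : IsK3Surface S) (hS' : IsK3Surface S') :
    ∃ c : ℂ, c ≠ 0 ∧
      ∀ (γ : HodgeTheory.complexBetti (MonoidalCategoryStruct.tensorObj S S') (2 * 2))
        (y : HodgeTheory.complexBetti S' (2 * 1)),
        Corr[μ, S, S', hS, hS' ; γ, y] = c • Corr[μ₀, S, S', hS, hS' ; γ, y] := by
  obtain ⟨c, hc, hcμ⟩ := HodgeTheory.complexGysin_eq_smul_of_orientationFamily hμ₀ hμ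
    (Motives.IsSmoothProjective.tensor_holds hS.isSmoothProjective hS'.isSmoothProjective)
    hS.isSmoothProjective (SemiCartesianMonoidalCategory.fst S S')
    (rfl : 2 * 1 + 2 * 2 + 2 * 2 = 2 * 1 + 2 * (2 + 2))
  exact ⟨c, hc, fun γ y => by rw [hcμ, LinearMap.smul_apply]⟩

/-- `[γ]_* y` is `ℂ`-linear in `γ`: `[t • γ]_* y = t • [γ]_* y` (cup product and Gysin morphism are
`ℂ`-linear). [cite: FultonYoungTableaux1997, Appendix B §B.1 (5)] -/
theorem corr_smul_left (μ : HodgeTheory.OrientationFamily) {S S' : Motives.SchemeOver ℂ}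
    (hS : IsK3Surface S) (hS' : IsK3Surface S') (t : ℂ)
    (γ : HodgeTheory.complexBetti (MonoidalCategoryStruct.tensorObj S S') (2 * 2))
    (y : HodgeTheory.complexBetti S' (2 * 1)) :
    Corr[μ, S, S', hS, hS' ; t • γ, y] = t • Corr[μ, S, S', hS, hS' ; γ, y] := by
  rw [map_smul, map_smul]

/-- `[γ]_* y` is `ℂ`-linear in `y`: `[γ]_* (t • y) = t • [γ]_* y` (pull-back, cup product and Gysin
morphism are `ℂ`-linear). [cite: FultonYoungTableaux1997, Appendix B §B.1 (1), (5)] -/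
theorem corr_smul_right (μ : HodgeTheory.OrientationFamily) {S S' : Motives.SchemeOver ℂ}
    (hS : IsK3Surface S) (hS' : IsK3Surface S') (t : ℂ)
    (γ : HodgeTheory.complexBetti (MonoidalCategoryStruct.tensorObj S S') (2 * 2))
    (y : HodgeTheory.complexBetti S' (2 * 1)) :
    Corr[μ, S, S', hS, hS' ; γ, t • y] = t • Corr[μ, S, S', hS, hS' ; γ, y] := by
  rw [map_smul, map_smul, LinearMap.smul_apply, map_smul]

/-- **Prop. 6.2 for reflective isometries at one orientation family gives it at all of them.**
If, at some family `μ₀` with Poincaré duality, every reflective rational Hodge isometry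
`η⁻¹ ∘ s_v ∘ η'` between marked projective K3 surfaces (with `s_v x' ∈ ℂ x`) is `[γ]_*^{μ₀}` for an
algebraic `γ`, then the same holds at every family `μ` with Poincaré duality, with the class
`c⁻¹ • γ`, `[·]_*^μ = c • [·]_*^{μ₀}` (`corr_eq_smul_of_orientationFamily`). This is the hypothesis
`hrefl` of `Buskin2019_hodgeIsometry_algebraic_of_reflective` obtained from its instance at `μ₀`.
[cite: Buskin2019, Prop. 6.2] [cite: FultonYoungTableaux1997, Appendix B §B.1 (5)] -/
theorem reflective_of_orientationFamily {μ₀ : HodgeTheory.OrientationFamily}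
    (hμ₀ : μ₀.HasPoincareDuality)
    (hrefl₀ : ∀ (S S' : Motives.SchemeOver ℂ) (hS : IsK3Surface S) (hS' : IsK3Surface S')
      (η : HodgeTheory.complexBetti S (2 * 1) ≃ₗ[ℂ] (K3Index → ℂ))
      (p : HodgeTheory.complexBetti S (2 * 2)) (x : K3Index → ℂ)
      (η' : HodgeTheory.complexBetti S' (2 * 1) ≃ₗ[ℂ] (K3Index → ℂ))
      (p' : HodgeTheory.complexBetti S' (2 * 2)) (x' : K3Index → ℂ),
      MarkedK3[S, η, p, x] → PeriodPt[x] → MarkedK3[S', η', p', x'] → PeriodPt[x'] →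
      ∀ v : K3Index → ℤ, ∑ i, ∑ j, v i * k3Gram i j * v j ≠ 0 →
      (∃ t : ℂ, k3ReflectionC v x' = t • x) →
      ∃ γ ∈ HodgeTheory.algebraicClasses (MonoidalCategoryStruct.tensorObj S S') 2,
        ∀ y : HodgeTheory.complexBetti S' (2 * 1),
          η.symm (k3ReflectionC v (η' y)) = Corr[μ₀, S, S', hS, hS' ; γ, y]) :
    ∀ (μ : HodgeTheory.OrientationFamily), μ.HasPoincareDuality →
      ∀ (S S' : Motives.SchemeOver ℂ) (hS : IsK3Surface S) (hS' : IsK3Surface S')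
      (η : HodgeTheory.complexBetti S (2 * 1) ≃ₗ[ℂ] (K3Index → ℂ))
      (p : HodgeTheory.complexBetti S (2 * 2)) (x : K3Index → ℂ)
      (η' : HodgeTheory.complexBetti S' (2 * 1) ≃ₗ[ℂ] (K3Index → ℂ))
      (p' : HodgeTheory.complexBetti S' (2 * 2)) (x' : K3Index → ℂ),
      MarkedK3[S, η, p, x] → PeriodPt[x] → MarkedK3[S', η', p', x'] → PeriodPt[x'] →
      ∀ v : K3Index → ℤ, ∑ i, ∑ j, v i * k3Gram i j * v j ≠ 0 →
      (∃ t : ℂ, k3ReflectionC v x' = t • x) →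
      ∃ γ ∈ HodgeTheory.algebraicClasses (MonoidalCategoryStruct.tensorObj S S') 2,
        ∀ y : HodgeTheory.complexBetti S' (2 * 1),
          η.symm (k3ReflectionC v (η' y)) = Corr[μ, S, S', hS, hS' ; γ, y] := by
  intro μ hμ S S' hS hS' η p x η' p' x' hm hx hm' hx' v hv ht
  obtain ⟨γ, hγ, hγeq⟩ := hrefl₀ S S' hS hS' η p x η' p' x' hm hx hm' hx' v hv ht
  obtain ⟨c, hc, hcμ⟩ := corr_eq_smul_of_orientationFamily hμ₀ hμ hS hS'
  refine ⟨c⁻¹ • γ, Submodule.smul_mem _ _ hγ, fun y => ?_⟩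
  rw [hcμ, corr_smul_left μ₀ hS hS', smul_smul, mul_inv_cancel₀ hc, one_smul]
  exact hγeq y

/-- **Lemma 6.3 (composition of algebraic correspondences between K3 surfaces) at one orientation
family gives it at all of them.** If at `μ₀` every pair of algebraic classes
`γ ∈ H⁴((S ⊗ S')(ℂ))`, `γ' ∈ H⁴((S' ⊗ S'')(ℂ))` has an algebraic `γ''` on `S ⊗ S''` with
`[γ'']_*^{μ₀} = [γ]_*^{μ₀} ∘ [γ']_*^{μ₀}` on `H²(S''(ℂ); ℂ)`, then at any `μ` the class
`(c₃⁻¹ c₁ c₂) • γ''` works, where `c₁, c₂, c₃ ≠ 0` compare `[·]_*^μ` with `[·]_*^{μ₀}` for the pairs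
`(S, S')`, `(S', S'')`, `(S, S'')` (`corr_eq_smul_of_orientationFamily`). This is the hypothesis
`hcomp` of `Buskin2019_hodgeIsometry_algebraic_of_reflective` obtained from its instance at `μ₀`.
[cite: Buskin2019, Lemma 6.3] [cite: Fulton1998, Prop. 16.1.1] [cite: FultonYoungTableaux1997, Appendix B §B.1 (5)] -/
theorem corrComp_of_orientationFamily {μ₀ : HodgeTheory.OrientationFamily}
    (hμ₀ : μ₀.HasPoincareDuality)
    (hcomp₀ : ∀ (S S' S'' : Motives.SchemeOver ℂ) (hS : IsK3Surface S) (hS' : IsK3Surface S')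
      (hS'' : IsK3Surface S''),
      ∀ γ ∈ HodgeTheory.algebraicClasses (MonoidalCategoryStruct.tensorObj S S') 2,
      ∀ γ' ∈ HodgeTheory.algebraicClasses (MonoidalCategoryStruct.tensorObj S' S'') 2,
      ∃ γ'' ∈ HodgeTheory.algebraicClasses (MonoidalCategoryStruct.tensorObj S S'') 2,
        ∀ y : HodgeTheory.complexBetti S'' (2 * 1),
          Corr[μ₀, S, S'', hS, hS'' ; γ'', y] =
            Corr[μ₀, S, S', hS, hS' ; γ, Corr[μ₀, S', S'', hS', hS'' ; γ', y]]) :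
    ∀ (μ : HodgeTheory.OrientationFamily), μ.HasPoincareDuality →
      ∀ (S S' S'' : Motives.SchemeOver ℂ) (hS : IsK3Surface S) (hS' : IsK3Surface S')
      (hS'' : IsK3Surface S''),
      ∀ γ ∈ HodgeTheory.algebraicClasses (MonoidalCategoryStruct.tensorObj S S') 2,
      ∀ γ' ∈ HodgeTheory.algebraicClasses (MonoidalCategoryStruct.tensorObj S' S'') 2,
      ∃ γ'' ∈ HodgeTheory.algebraicClasses (MonoidalCategoryStruct.tensorObj S S'') 2,
        ∀ y : HodgeTheory.complexBetti S'' (2 * 1),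
          Corr[μ, S, S'', hS, hS'' ; γ'', y] =
            Corr[μ, S, S', hS, hS' ; γ, Corr[μ, S', S'', hS', hS'' ; γ', y]] := by
  intro μ hμ S S' S'' hS hS' hS'' γ hγ γ' hγ'
  obtain ⟨γ'', hγ'', hγeq⟩ := hcomp₀ S S' S'' hS hS' hS'' γ hγ γ' hγ'
  obtain ⟨c₁, hc₁, h₁⟩ := corr_eq_smul_of_orientationFamily hμ₀ hμ hS hS'
  obtain ⟨c₂, hc₂, h₂⟩ := corr_eq_smul_of_orientationFamily hμ₀ hμ hS' hS''
  obtain ⟨c₃, hc₃, h₃⟩ := corr_eq_smul_of_orientationFamily hμ₀ hμ hS hS''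
  refine ⟨(c₃⁻¹ * (c₁ * c₂)) • γ'', Submodule.smul_mem _ _ hγ'', fun y => ?_⟩
  rw [h₃, corr_smul_left μ₀ hS hS'', smul_smul, ← mul_assoc, mul_inv_cancel₀ hc₃, one_mul, hγeq y,
    h₁, h₂, corr_smul_right μ₀ hS hS', smul_smul]

/-- **Buskin's Theorem 1.1 from the two period facts of the tree and its two remaining printed
ingredients AT ONE ORIENTATION FAMILY.** Granted the named facts
`h : Huybrechts_K3_periodSurjective_projective` (surjectivity of the period map, projective form)
and `hM : Huybrechts_K3_marking_exists` (markings with projective periods), and, at a single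
orientation family `μ₀` with Poincaré duality (every family has it:
`HodgeTheory.OrientationFamily.hasPoincareDuality`, `GysinKernelProofs`), Buskin's Prop. 6.2 for
the reflective rational Hodge isometries `η⁻¹ ∘ s_v ∘ η'` between marked projective K3 surfaces
(`hrefl₀`) and his Lemma 6.3 with the composition rule `[γ'']_* = [γ]_* ∘ [γ']_*` for algebraic
correspondences between K3 surfaces (`hcomp₀`), the named fact
`Buskin2019_hodgeIsometry_algebraic` follows — by `Buskin2019_hodgeIsometry_algebraic_of_marking`
after transporting the two hypotheses to every orientation family
(`reflective_of_orientationFamily`, `corrComp_of_orientationFamily`).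
[cite: Buskin2019, Thm. 1.1 and §6.2 (proof of Thm. 1.1, Prop. 6.2, Lemma 6.3)] [cite: Huybrechts2019, §1.1]
[cite: FultonYoungTableaux1997, Appendix B §B.1 (5)] -/
theorem Buskin2019_hodgeIsometry_algebraic_of_reflective_at (μ₀ : HodgeTheory.OrientationFamily)
    (hμ₀ : μ₀.HasPoincareDuality)
    (h : Huybrechts_K3_periodSurjective_projective) (hM : Huybrechts_K3_marking_exists)
    (hrefl₀ : ∀ (S S' : Motives.SchemeOver ℂ) (hS : IsK3Surface S) (hS' : IsK3Surface S')
      (η : HodgeTheory.complexBetti S (2 * 1) ≃ₗ[ℂ] (K3Index → ℂ))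
      (p : HodgeTheory.complexBetti S (2 * 2)) (x : K3Index → ℂ)
      (η' : HodgeTheory.complexBetti S' (2 * 1) ≃ₗ[ℂ] (K3Index → ℂ))
      (p' : HodgeTheory.complexBetti S' (2 * 2)) (x' : K3Index → ℂ),
      MarkedK3[S, η, p, x] → PeriodPt[x] → MarkedK3[S', η', p', x'] → PeriodPt[x'] →
      ∀ v : K3Index → ℤ, ∑ i, ∑ j, v i * k3Gram i j * v j ≠ 0 →
      (∃ t : ℂ, k3ReflectionC v x' = t • x) →
      ∃ γ ∈ HodgeTheory.algebraicClasses (MonoidalCategoryStruct.tensorObj S S') 2,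
        ∀ y : HodgeTheory.complexBetti S' (2 * 1),
          η.symm (k3ReflectionC v (η' y)) = Corr[μ₀, S, S', hS, hS' ; γ, y])
    (hcomp₀ : ∀ (S S' S'' : Motives.SchemeOver ℂ) (hS : IsK3Surface S) (hS' : IsK3Surface S')
      (hS'' : IsK3Surface S''),
      ∀ γ ∈ HodgeTheory.algebraicClasses (MonoidalCategoryStruct.tensorObj S S') 2,
      ∀ γ' ∈ HodgeTheory.algebraicClasses (MonoidalCategoryStruct.tensorObj S' S'') 2,
      ∃ γ'' ∈ HodgeTheory.algebraicClasses (MonoidalCategoryStruct.tensorObj S S'') 2,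
        ∀ y : HodgeTheory.complexBetti S'' (2 * 1),
          Corr[μ₀, S, S'', hS, hS'' ; γ'', y] =
            Corr[μ₀, S, S', hS, hS' ; γ, Corr[μ₀, S', S'', hS', hS'' ; γ', y]]) :
    Buskin2019_hodgeIsometry_algebraic :=
  Buskin2019_hodgeIsometry_algebraic_of_marking h hM (reflective_of_orientationFamily hμ₀ hrefl₀)
    (corrComp_of_orientationFamily hμ₀ hcomp₀)

end OrientationTransport

end Literature.AlgebraicGeometry.Surfaces

end
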